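import Mathlib
import Literature.NumberTheory.ModularForms.LevelThreeForms
import Literature.NumberTheory.ModularForms.LevelThreeEisensteinZeros
import Literature.NumberTheory.ModularForms.LevelThreeReduction
import Literature.NumberTheory.Automorphic.HeckeTriangleEichlerGreen
import HarnessLib

/-!
# The level-three weight-4 Green function at `(3+i√3)/6` as an Eichler integral of `Δ₃/𝓟`

[topic NumberTheory/Automorphic]

Support file for `Literature.NumberTheory.Automorphic.Zhou2015_legendreP_sq_integral`
(Zhou 2015, Remark 9, level `3`): the automorphic Green function `G₂^{Γ₀(3)}(z, c₃)`,
`c₃ = (3 + i√3)/6 = cmLevelThree` (the elliptic point of order `3` of `Γ₀(3)`), is constructed from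
the Eichler integral of the weight-4 form `f₃ = Δ₃/𝓟` of `LevelThreeForms.lean` (`𝓟` has a double
zero on the orbit of `c₃`, `LevelThreeEisensteinZeros.lean`) through the generic Hecke-triangle
construction of `HeckeTriangleEichlerGreen.lean` in the coordinate `v = √3 z` (in which
`Γ₀(3)⁺ = ⟨T, W₃⟩` becomes `⟨T^{√3}, S⟩`), extended to `ℍ` through the fundamental domain
`𝒟₃ = {|Re| ≤ ½, |z|² ≥ ⅓}` of `LevelThreeReduction.lean`, and matched with the tree's
`higherGreen 3 2 1 · cmLevelThree` by uniqueness of resolvent Green functions.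

## Main results (sorry-free)

* `dataThree : HeckeFormData` (`g = f₃(·/√3)`, `a = 1/2`, `per = √3`);
* `FThree`, `isResolventGreenLike_FThree : IsResolventGreenLike 3 2 cmLevelThree FThree` (given
  `Im M₁(i) = 0`);
* the local expansion of `f₃(·/√3)` at `p₃ = √3c₃` with leading coefficient
  `α₃ = 6Δ₃(c₃)/𝓟''(c₃) = 1/(4π²)` (`LevelThreeForms.deltaThree_cmLevelThree_eq_PE2`),
  `FThree_log_bound` (six local representatives near the corner), `card_stabilizer_cmLevelThree = 6`,
  and **`higherGreen 3 2 1 z cmLevelThree = −24π² · FThree z`** (`higherGreen_eq_CThree_mul_FThree`);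
* **Remark 9 (iv)a from the axis inputs** (`higherGreen_cmLevelThree_of_axis`): if `f₃(it)` is real
  and `∫_{t>1/√3} f₃(it) dt = (108π)⁻¹ L`, then
  `higherGreen 3 2 1 cmLevelThree cmLevelThree' = −(4π/(3√3))·L`.

## References

* Y. Zhou, *Kontsevich–Zagier integrals for automorphic Green's functions. I*, Ramanujan J. 38
  (2015), Remark 9, eq. (G2_Hecke2_spec_val). [cite: Zhou2015, Remark 9]
* B. Gross, D. Zagier, Invent. Math. 84 (1986), §II.2. [cite: GrossZagier1986, §II.2]
-/

noncomputable section

open UpperHalfPlane hiding I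
open Complex Filter Topology ModularForm Real Set MeasureTheory Laplacian CongruenceSubgroup
open scoped MatrixGroups Manifold Topology

namespace Literature.NumberTheory.Automorphic.GreenThree

open Literature.NumberTheory.ModularForms
open Literature.NumberTheory.Automorphic.HeckeFormData

/-! ## 1. The scaled form `g₃(v) = f₃(v/√3)` and the datum `dataThree` -/

/-- `√3`. [folklore] -/
def s3 : ℝ := Real.sqrt 3

/-- `√3 > 0`. [folklore] -/
theorem s3_pos : 0 < s3 := by rw [s3]; positivity

/-- `√3² = 3`. [folklore] -/
theorem s3_sq : s3 ^ 2 = 3 := by rw [s3, Real.sq_sqrt (by norm_num)]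

/-- `√3·√3 = 3`. [folklore] -/
theorem s3_mul_s3 : s3 * s3 = 3 := by rw [← sq, s3_sq]

/-- `1 < √3`. [folklore] -/
theorem one_lt_s3 : 1 < s3 := by
  rw [s3]
  have : Real.sqrt 1 < Real.sqrt 3 := Real.sqrt_lt_sqrt (by norm_num) (by norm_num)
  simpa using this

/-- `√3 < 2`. [folklore] -/
theorem s3_lt_two : s3 < 2 := by nlinarith [s3_mul_s3, s3_pos, one_lt_s3]

/-- `(√3 : ℂ) ≠ 0`. [folklore] -/
theorem s3C_ne_zero : (s3 : ℂ) ≠ 0 := by exact_mod_cast s3_pos.ne'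

/-- `√3/6 = 1/(2√3)`: `s3/6 * s3 = 1/2`. [folklore] -/
theorem s3_div_six_mul_s3 : s3 / 6 * s3 = 1 / 2 := by nlinarith [s3_mul_s3]

/-- `v ↦ v/√3` on `ℍ`. [folklore] -/
def scaleDown (τ : ℍ) : ℍ := ⟨(τ : ℂ) / s3, by
  rw [Complex.div_ofReal_im]; exact div_pos τ.im_pos s3_pos⟩

/-- `z ↦ √3 z` on `ℍ`. [folklore] -/
def scaleUp (τ : ℍ) : ℍ := ⟨(s3 : ℂ) * τ, by
  rw [Complex.mul_im, Complex.ofReal_re, Complex.ofReal_im]; simp; exact mul_pos s3_pos τ.im_pos⟩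

/-- Coordinates. [folklore] -/
@[simp] theorem coe_scaleDown (τ : ℍ) : ((scaleDown τ : ℍ) : ℂ) = (τ : ℂ) / s3 := rfl

/-- Coordinates. [folklore] -/
@[simp] theorem coe_scaleUp (τ : ℍ) : ((scaleUp τ : ℍ) : ℂ) = (s3 : ℂ) * τ := rfl

/-- Heights. [folklore] -/
theorem scaleDown_im (τ : ℍ) : (scaleDown τ).im = τ.im / s3 := by
  rw [← UpperHalfPlane.coe_im, coe_scaleDown, Complex.div_ofReal_im, UpperHalfPlane.coe_im]

/-- Heights. [folklore] -/
theorem scaleUp_im (τ : ℍ) : (scaleUp τ).im = s3 * τ.im := by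
  rw [← UpperHalfPlane.coe_im, coe_scaleUp, Complex.mul_im]; simp

/-- `scaleDown ∘ scaleUp = id`. [folklore] -/
theorem scaleDown_scaleUp (τ : ℍ) : scaleDown (scaleUp τ) = τ := by
  apply UpperHalfPlane.ext; simp [mul_div_cancel_left₀ _ s3C_ne_zero]

/-- `scaleDown` through `ofComplex`. [folklore] -/
theorem scaleDown_ofComplex {w : ℂ} (hw : 0 < w.im) : scaleDown (ofComplex w) = ofComplex (w / s3) := by
  have hw' : 0 < (w / s3).im := by rw [Complex.div_ofReal_im]; exact div_pos hw s3_pos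
  apply UpperHalfPlane.ext
  rw [coe_scaleDown, ofComplex_apply_of_im_pos hw, ofComplex_apply_of_im_pos hw']

/-- `scaleDown (S • τ) = W₃ (scaleDown τ)`: the Fricke involution becomes `S`. [folklore] -/
theorem scaleDown_S_smul (τ : ℍ) : scaleDown (ModularGroup.S • τ) = frickeThree (scaleDown τ) := by
  apply UpperHalfPlane.ext
  rw [coe_scaleDown, coe_frickeThree, coe_scaleDown, UpperHalfPlane.modular_S_smul, coe_mk]
  have hτ : (τ : ℂ) ≠ 0 := τ.ne_zero
  have hs := s3C_ne_zero
  have h3 : (3 : ℂ) = (s3 : ℂ) * s3 := by exact_mod_cast s3_mul_s3.symm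
  rw [h3]
  field_simp

/-- `scaleDown (√3 +ᵥ τ) = 1 +ᵥ scaleDown τ`. [folklore] -/
theorem scaleDown_vadd (τ : ℍ) : scaleDown ((s3 : ℝ) +ᵥ τ) = (1 : ℝ) +ᵥ scaleDown τ := by
  apply UpperHalfPlane.ext
  rw [coe_scaleDown, UpperHalfPlane.coe_vadd, UpperHalfPlane.coe_vadd, coe_scaleDown]
  push_cast
  rw [add_div, div_self s3C_ne_zero]

/-- `scaleDown → i∞`. [folklore] -/
theorem tendsto_scaleDown_atImInfty : Tendsto scaleDown atImInfty atImInfty := by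
  rw [atImInfty, tendsto_comap_iff]
  have : (UpperHalfPlane.im ∘ scaleDown) = fun τ => τ.im / s3 := funext fun τ => scaleDown_im τ
  rw [this]
  exact Filter.Tendsto.atTop_div_const s3_pos tendsto_comap

/-- `f₃ ∘ ofComplex` is holomorphic at `w` with `Im w > √3/6` (`𝓟 ≠ 0` there). [folklore] -/
theorem differentiableAt_fThree {w : ℂ} (hw : Real.sqrt 3 / 6 < w.im) : DifferentiableAt ℂ (fThree ∘ ofComplex) w := by
  have hw0 : 0 < w.im := lt_trans (by positivity) hw
  have hΔ := differentiableAt_deltaThree hw0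
  have hE := differentiableAt_eisThree hw0
  have hne : (eisThree ∘ ofComplex) w ≠ 0 := by
    apply eisThree_ne_zero_of_im_gt
    rwa [← UpperHalfPlane.coe_im, ofComplex_apply_of_im_pos hw0]
  exact (hΔ.div hE hne).congr_of_eventuallyEq (Eventually.of_forall fun u => rfl)

/-- **The scaled level-three form** `g₃(v) := f₃(v/√3)`. [folklore] -/
def gThree (τ : ℍ) : ℂ := fThree (scaleDown τ)

/-- **The level-three Hecke datum**: `g₃`, pole height `1/2`, period `√3`. [folklore] -/
def dataThree : HeckeFormData where
  g := gThree
  a := 1 / 2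
  per := s3
  a_pos := by norm_num
  a_lt_one := by norm_num
  per_pos := s3_pos
  per_le_two := s3_lt_two.le
  differentiableAt_g w hw := by
    have hw0 : 0 < w.im := lt_trans (by norm_num) hw
    have hw2 : Real.sqrt 3 / 6 < (w / s3).im := by
      rw [Complex.div_ofReal_im, lt_div_iff₀ s3_pos, show Real.sqrt 3 = s3 from rfl]
      nlinarith [s3_mul_s3]
    have h1 := differentiableAt_fThree hw2
    have h2 : DifferentiableAt ℂ (fun u : ℂ => u / s3) w := differentiableAt_id.div_const _
    have h := DifferentiableAt.comp (g := fThree ∘ ofComplex) w h1 h2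
    refine h.congr_of_eventuallyEq ?_
    filter_upwards [isOpen_upperHalfPlaneSet.mem_nhds hw0] with u hu
    simp only [Function.comp_apply, gThree]
    rw [scaleDown_ofComplex hu]
  S_law τ := by
    rw [gThree, gThree, scaleDown_S_smul, fThree_fricke, coe_scaleDown]
    have h3 : (s3 : ℂ) ^ 4 = 9 := by
      rw [show (4:ℕ) = 2 * 2 from rfl, pow_mul]; norm_cast; rw [s3_sq]; norm_num
    field_simp
    rw [h3]; ring
  T_law τ := by rw [gThree, gThree, scaleDown_vadd, fThree_vadd_one]
  tendsto_g := tendsto_fThree_atImInfty.comp tendsto_scaleDown_atImInfty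

/-- The pole height of `dataThree`. [folklore] -/
@[simp] theorem dataThree_a : dataThree.a = 1 / 2 := rfl

/-- The period of `dataThree`. [folklore] -/
@[simp] theorem dataThree_per : dataThree.per = s3 := rfl

/-- The function of `dataThree`. [folklore] -/
@[simp] theorem dataThree_g : dataThree.g = gThree := rfl

/-! ## 2. The corner `c₃ = (3 + i√3)/6`, its orbit and the fundamental domain -/

/-- Coordinates of `cmLevelThree`. [folklore] -/
theorem cmLevelThree_re : cmLevelThree.re = 1 / 2 := by simp [cmLevelThree, UpperHalfPlane.re]

/-- Coordinates of `cmLevelThree`. [folklore] -/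
theorem cmLevelThree_im : cmLevelThree.im = Real.sqrt 3 / 6 := by simp [cmLevelThree, UpperHalfPlane.im]

/-- `Im c₃ = s3/6`. [folklore] -/
theorem cmLevelThree_im' : cmLevelThree.im = s3 / 6 := cmLevelThree_im

/-- `|c₃|² = 1/3`. [folklore] -/
theorem normSq_cmLevelThree : Complex.normSq ((cmLevelThree : ℍ) : ℂ) = 1 / 3 := by
  rw [coe_cmLevelThree, Complex.normSq_mk]
  have hs : Real.sqrt 3 * Real.sqrt 3 = 3 := Real.mul_self_sqrt (by norm_num)
  nlinarith [hs]

/-- `c₃ ∈ 𝒟₃` (a corner). [folklore] -/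
theorem cmLevelThree_mem_fdThree : cmLevelThree ∈ fdThree := by
  refine ⟨?_, by rw [normSq_cmLevelThree]⟩
  rw [cmLevelThree_re, abs_le]; constructor <;> norm_num

/-- `W₃ c₃ = c₃ − 1`. [folklore] -/
theorem frickeThree_cmLevelThree : frickeThree cmLevelThree = (-1 : ℝ) +ᵥ cmLevelThree := by
  apply UpperHalfPlane.ext
  rw [coe_frickeThree, UpperHalfPlane.coe_vadd, coe_cmLevelThree]
  have hs : Real.sqrt 3 * Real.sqrt 3 = 3 := Real.mul_self_sqrt (by norm_num)
  have hne : (3 : ℂ) * (⟨1 / 2, Real.sqrt 3 / 6⟩ : ℂ) ≠ 0 := by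
    intro h
    have := congrArg Complex.re h
    simp at this
  rw [div_eq_iff hne]
  apply Complex.ext
  · simp [Complex.mul_re]; nlinarith [hs]
  · simp [Complex.mul_im]; nlinarith [hs]

/-- `z − 1 = T⁻¹ • z`. [folklore] -/
theorem vadd_neg_one_eq_T_inv_smul (z : ℍ) : (-1 : ℝ) +ᵥ z = ModularGroup.T⁻¹ • z := by
  have := UpperHalfPlane.modular_T_zpow_smul z (-1)
  rw [zpow_neg_one] at this
  rw [this]; norm_num

/-- `T⁻¹ ∈ Γ₀(3)`. [folklore] -/
theorem T_inv_mem_Gamma0_three : ModularGroup.T⁻¹ ∈ Gamma0 3 := by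
  rw [mem_Gamma0_three_iff]; simp [ModularGroup.T, Matrix.SpecialLinearGroup.coe_inv, Matrix.adjugate_fin_two]

/-- The corner orbit. [folklore] -/
def cornerOrb : Set ℍ := orbThree cmLevelThree

/-- **The `Γ₀(3)`-orbit of `c₃` is its `Γ₀(3)⁺`-orbit** (`W₃c₃ = T⁻¹c₃`). [folklore] -/
theorem mem_orbit_iff_mem_cornerOrb (z : ℍ) :
    z ∈ MulAction.orbit (Gamma0 3) cmLevelThree ↔ z ∈ cornerOrb := by
  constructor
  · rintro ⟨g, rfl⟩
    exact ⟨(g : SL(2, ℤ)), g.2, Or.inl rfl⟩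
  · rintro ⟨γ, hγ, h | h⟩
    · exact ⟨⟨γ, hγ⟩, h.symm⟩
    · refine ⟨⟨γ * ModularGroup.T⁻¹, Subgroup.mul_mem _ hγ T_inv_mem_Gamma0_three⟩, ?_⟩
      rw [h, frickeThree_cmLevelThree, vadd_neg_one_eq_T_inv_smul]
      simp [mul_smul]

/-- Orbit points of the corner have height `≤ √3/6`. [folklore] -/
theorem im_le_of_mem_cornerOrb {z : ℍ} (hz : z ∈ cornerOrb) : z.im ≤ Real.sqrt 3 / 6 := by
  have := im_le_of_mem_orbThree cmLevelThree_mem_fdThree hz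
  rwa [cmLevelThree_im] at this

/-- Membership in the corner orbit is a property of the orbit. [folklore] -/
theorem mem_cornerOrb_iff_of_mem_orbThree {z u : ℍ} (hu : u ∈ orbThree z) : u ∈ cornerOrb ↔ z ∈ cornerOrb := by
  rw [cornerOrb]
  constructor
  · intro h
    have h1 : cmLevelThree ∈ orbThree u := mem_orbThree_symm h
    rw [orbThree_eq_of_mem hu] at h1
    exact mem_orbThree_symm h1
  · intro h
    have h1 : cmLevelThree ∈ orbThree z := mem_orbThree_symm h
    rw [← orbThree_eq_of_mem hu] at h1
    exact mem_orbThree_symm h1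

/-- `γ • z` is in the corner orbit iff `z` is. [folklore] -/
theorem smul_mem_cornerOrb_iff {γ : SL(2, ℤ)} (hγ : γ ∈ Gamma0 3) (z : ℍ) :
    γ • z ∈ cornerOrb ↔ z ∈ cornerOrb :=
  mem_cornerOrb_iff_of_mem_orbThree (smul_mem_orbThree hγ z)

/-- `W₃ z` is in the corner orbit iff `z` is. [folklore] -/
theorem frickeThree_mem_cornerOrb_iff (z : ℍ) : frickeThree z ∈ cornerOrb ↔ z ∈ cornerOrb :=
  mem_cornerOrb_iff_of_mem_orbThree (frickeThree_mem_orbThree z)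

/-- `(√3/6)² = 1/12`, so `Im² > 1/12 ↔ Im > √3/6` for points of `ℍ`. [folklore] -/
theorem im_sq_gt_iff (u : ℍ) : 1 / 12 < u.im ^ 2 ↔ Real.sqrt 3 / 6 < u.im := by
  have hs : Real.sqrt 3 * Real.sqrt 3 = 3 := Real.mul_self_sqrt (by norm_num)
  have h0 := u.im_pos
  have hs0 : 0 < Real.sqrt 3 := Real.sqrt_pos.mpr (by norm_num)
  constructor
  · intro h; nlinarith
  · intro h; nlinarith

/-- **Points of `𝒟₃` off the corner orbit have `Im > √3/6`.** [folklore] -/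
theorem im_gt_of_mem_fdThree {u : ℍ} (hu : u ∈ fdThree) (hno : u ∉ cornerOrb) : Real.sqrt 3 / 6 < u.im := by
  rcases (im_sq_ge_of_mem_fdThree hu).lt_or_eq with h | h
  · exact (im_sq_gt_iff u).mp h
  · exfalso
    obtain ⟨hre, hn⟩ := corner_of_im_sq_eq hu h.symm
    have hs : Real.sqrt 3 * Real.sqrt 3 = 3 := Real.mul_self_sqrt (by norm_num)
    have him : u.im = Real.sqrt 3 / 6 := by
      have h0 := u.im_pos
      have hs0 : 0 < Real.sqrt 3 := Real.sqrt_pos.mpr (by norm_num)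
      nlinarith
    apply hno
    rcases hre with hr | hr
    · have : u = cmLevelThree := by
        apply UpperHalfPlane.ext; apply Complex.ext
        · rw [UpperHalfPlane.coe_re, hr, coe_cmLevelThree]
        · rw [UpperHalfPlane.coe_im, him, coe_cmLevelThree]
      rw [this]; exact mem_orbThree_self _
    · -- left corner `c₃ − 1 = W₃ c₃`
      have : u = frickeThree cmLevelThree := by
        rw [frickeThree_cmLevelThree]
        apply UpperHalfPlane.ext; apply Complex.ext
        · rw [UpperHalfPlane.coe_re, hr, UpperHalfPlane.coe_vadd, Complex.add_re, Complex.ofReal_re,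
            coe_cmLevelThree]; norm_num
        · rw [UpperHalfPlane.coe_im, him, UpperHalfPlane.coe_vadd, Complex.add_im, Complex.ofReal_im,
            coe_cmLevelThree]; norm_num
      rw [this]; exact frickeThree_mem_orbThree _

/-! ## 3. The key compatibility lemma and the extension `FThree` -/

/-- `√3 u` as a complex number. [folklore] -/
def sc (u : ℍ) : ℂ := (s3 : ℂ) * u

/-- Imaginary part of `√3 u`. [folklore] -/
theorem sc_im (u : ℍ) : (sc u).im = s3 * u.im := by rw [sc, Complex.mul_im]; simp

/-- `a = 1/2 < Im(√3 u)` if `√3/6 < Im u`. [folklore] -/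
theorem a_lt_sc_im {u : ℍ} (hu : Real.sqrt 3 / 6 < u.im) : dataThree.a < (sc u).im := by
  rw [dataThree_a, sc_im]
  rw [show Real.sqrt 3 = s3 from rfl] at hu
  nlinarith [s3_pos, s3_mul_s3]

/-- `√3 (n +ᵥ u) = √3 u + n·√3`. [folklore] -/
theorem sc_vadd (n : ℤ) (u : ℍ) : sc (((n : ℝ)) +ᵥ u) = sc u + n * dataThree.per := by
  rw [sc, sc, UpperHalfPlane.coe_vadd, dataThree_per]; push_cast; ring

/-- `√3 · W₃ u = Sc (√3 u)`. [folklore] -/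
theorem sc_frickeThree (u : ℍ) : sc (frickeThree u) = GreenRho.Sc (sc u) := by
  rw [sc, sc, coe_frickeThree, GreenRho.Sc]
  have hu : (u : ℂ) ≠ 0 := u.ne_zero
  have hs := s3C_ne_zero
  have h3 : (3 : ℂ) = (s3 : ℂ) * s3 := by exact_mod_cast s3_mul_s3.symm
  rw [h3]
  field_simp

/-- A point with `Im u > √3/6` and `3|u|² < 2√3 Im u` gives `√3u` in the lens. [folklore] -/
theorem sc_mem_lens {u : ℍ} (hu : Real.sqrt 3 / 6 < u.im) (hn : 3 * Complex.normSq (u : ℂ) < 2 * s3 * u.im) :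
    sc u ∈ dataThree.lens := by
  refine ⟨a_lt_sc_im hu, ?_⟩
  rw [dataThree_a, sc_im, sc, Complex.normSq_mul, Complex.normSq_ofReal, s3_mul_s3]
  nlinarith [s3_pos]

section KeyLemma

variable (hreal : (dataThree.M₁ Complex.I).im = 0)
include hreal

/-- **Key lemma**: two `𝒟₃`-representatives of one `Γ₀(3)⁺`-orbit, off the corner orbit, give the
same value of `Fbase ∘ √3`. [folklore] -/
theorem Fbase_sc_eq_of_mem_fdThree {u v : ℍ} (hu : u ∈ fdThree) (hv : v ∈ fdThree) (hvu : v ∈ orbThree u)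
    (hno : u ∉ cornerOrb) : dataThree.Fbase (sc v) = dataThree.Fbase (sc u) := by
  have him_u : Real.sqrt 3 / 6 < u.im := im_gt_of_mem_fdThree hu hno
  have hsq : 1 / 12 < u.im ^ 2 := (im_sq_gt_iff u).mpr him_u
  have h1 : v.im ≤ u.im := im_le_of_mem_orbThree hu hvu
  have h2 : u.im ≤ v.im := im_le_of_mem_orbThree hv (mem_orbThree_symm hvu)
  have heq : v.im = u.im := le_antisymm h1 h2
  obtain ⟨γ, hγ, h | h⟩ := hvu
  · have him : (γ • u).im = u.im := by rw [← h]; exact heq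
    obtain ⟨n, hn⟩ := eq_vadd_of_im_eq_three hu hsq γ hγ him
    rw [h, hn, sc_vadd]
    exact dataThree.Fbase_add_int_mul_per (a_lt_sc_im him_u) n
  · have him : (γ • frickeThree u).im = u.im := by rw [← h]; exact heq
    obtain ⟨hnorm, n, hn⟩ := eq_vadd_fricke_of_im_eq_three hu hsq γ hγ him
    have hWim : Real.sqrt 3 / 6 < (frickeThree u).im := by
      rw [im_frickeThree, hnorm]; simpa using him_u
    rw [h, hn, sc_vadd, dataThree.Fbase_add_int_mul_per (a_lt_sc_im hWim) n, sc_frickeThree]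
    apply dataThree.Fbase_Sc _ hreal
    apply sc_mem_lens him_u
    rw [hnorm]
    rw [show Real.sqrt 3 = s3 from rfl] at him_u
    nlinarith [s3_mul_s3, s3_pos]

end KeyLemma

/-- A chosen `𝒟₃`-representative of the orbit of `z`. [folklore] -/
def repThree (z : ℍ) : ℍ := Classical.choose (exists_mem_orbThree_mem_fdThree z)

/-- The representative lies in the orbit. [folklore] -/
theorem repThree_mem_orbThree (z : ℍ) : repThree z ∈ orbThree z := (Classical.choose_spec (exists_mem_orbThree_mem_fdThree z)).1

/-- The representative lies in `𝒟₃`. [folklore] -/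
theorem repThree_mem_fdThree (z : ℍ) : repThree z ∈ fdThree := (Classical.choose_spec (exists_mem_orbThree_mem_fdThree z)).2

open Classical in
/-- **The extension** `FThree z := Fbase(√3 · rep z)` off the corner orbit, `0` on it. [folklore] -/
def FThree (z : ℍ) : ℝ := if z ∈ cornerOrb then 0 else dataThree.Fbase (sc (repThree z))

section Extension

variable (hreal : (dataThree.M₁ Complex.I).im = 0)
include hreal

/-- `FThree z = Fbase(√3 u)` for ANY `𝒟₃`-representative `u` of the orbit of `z`. [folklore] -/
theorem FThree_eq_of_rep {z u : ℍ} (hz : z ∉ cornerOrb) (hu : u ∈ orbThree z) (hfd : u ∈ fdThree) :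
    FThree z = dataThree.Fbase (sc u) := by
  rw [FThree, if_neg hz]
  have huno : u ∉ cornerOrb := fun h => hz ((mem_cornerOrb_iff_of_mem_orbThree hu).mp h)
  have hrep : repThree z ∈ orbThree u := by
    rw [orbThree_eq_of_mem hu]; exact repThree_mem_orbThree z
  exact Fbase_sc_eq_of_mem_fdThree hreal hfd (repThree_mem_fdThree z) hrep huno

/-- **`FThree` is `Γ₀(3)`-invariant.** [folklore] -/
theorem FThree_smul {γ : SL(2, ℤ)} (hγ : γ ∈ Gamma0 3) (z : ℍ) : FThree (γ • z) = FThree z := by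
  by_cases hz : z ∈ cornerOrb
  · rw [FThree, FThree, if_pos hz, if_pos ((smul_mem_cornerOrb_iff hγ z).mpr hz)]
  · have hz' : γ • z ∉ cornerOrb := fun h => hz ((smul_mem_cornerOrb_iff hγ z).mp h)
    have hu : repThree z ∈ orbThree (γ • z) := by rw [orbThree_smul hγ]; exact repThree_mem_orbThree z
    rw [FThree_eq_of_rep hreal hz' hu (repThree_mem_fdThree z), FThree, if_neg hz]

/-- **`FThree` is `W₃`-invariant.** [folklore] -/
theorem FThree_frickeThree (z : ℍ) : FThree (frickeThree z) = FThree z := by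
  by_cases hz : z ∈ cornerOrb
  · rw [FThree, FThree, if_pos hz, if_pos ((frickeThree_mem_cornerOrb_iff z).mpr hz)]
  · have hz' : frickeThree z ∉ cornerOrb := fun h => hz ((frickeThree_mem_cornerOrb_iff z).mp h)
    have hu : repThree z ∈ orbThree (frickeThree z) := by rw [orbThree_frickeThree]; exact repThree_mem_orbThree z
    rw [FThree_eq_of_rep hreal hz' hu (repThree_mem_fdThree z), FThree, if_neg hz]

/-- `FThree` is invariant under integer translations. [folklore] -/
theorem FThree_vadd_int (n : ℤ) (z : ℍ) : FThree (((n : ℝ)) +ᵥ z) = FThree z := by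
  have h : ((n : ℝ)) +ᵥ z = (ModularGroup.T ^ n) • z := by rw [UpperHalfPlane.modular_T_zpow_smul]
  rw [h]
  apply FThree_smul hreal
  rw [mem_Gamma0_three_iff, ModularGroup.coe_T_zpow]; simp

end Extension

/-! ## 4. Local charts and regularity -/

section Regularity

variable (hreal : (dataThree.M₁ Complex.I).im = 0)
include hreal

omit hreal in
/-- `ofComplex u` off the corner orbit when `Im u > √3/6`. [folklore] -/
theorem notMem_cornerOrb_of_im {u : ℂ} (hu : Real.sqrt 3 / 6 < u.im) : ofComplex u ∉ cornerOrb := fun h => by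
  have := im_le_of_mem_cornerOrb h
  have hu0 : 0 < u.im := lt_trans (by positivity) hu
  rw [← UpperHalfPlane.coe_im, ofComplex_apply_of_im_pos hu0] at this
  linarith

/-- **Local chart**: near a point `u₀ ∈ 𝒟₃` off the corner orbit, `FThree ∘ ofComplex = Fbase ∘ √3`. [folklore] -/
theorem FThree_ofComplex_eventuallyEq {u₀ : ℍ} (hu₀ : u₀ ∈ fdThree) (hno : u₀ ∉ cornerOrb) :
    (fun u : ℂ => FThree (ofComplex u)) =ᶠ[𝓝 (u₀ : ℂ)] fun u => dataThree.Fbase ((s3 : ℂ) * u) := by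
  have him : Real.sqrt 3 / 6 < u₀.im := im_gt_of_mem_fdThree hu₀ hno
  have hs33 : Real.sqrt 3 * Real.sqrt 3 = 3 := Real.mul_self_sqrt (by norm_num)
  have hs30 : 0 < Real.sqrt 3 := Real.sqrt_pos.mpr (by norm_num)
  suffices h : ∀ᶠ u in 𝓝 (u₀ : ℂ), Real.sqrt 3 / 6 < u.im ∧
      ∃ v : ℍ, v ∈ orbThree (ofComplex u) ∧ v ∈ fdThree ∧ dataThree.Fbase (sc v) = dataThree.Fbase ((s3 : ℂ) * u) by
    filter_upwards [h] with u ⟨hu, v, hv, hfd, hF⟩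
    rw [FThree_eq_of_rep hreal (notMem_cornerOrb_of_im hu) hv hfd, hF]
  have hc_im : ∀ᶠ u in 𝓝 (u₀ : ℂ), Real.sqrt 3 / 6 < u.im :=
    Complex.continuous_im.continuousAt.eventually (lt_mem_nhds (by simpa using him))
  have hre0 : |u₀.re| ≤ 1 / 2 := hu₀.1
  have hn0 : 1 / 3 ≤ Complex.normSq (u₀ : ℂ) := hu₀.2
  have hsc : ∀ u : ℂ, 0 < u.im → sc (ofComplex u) = (s3 : ℂ) * u := fun u hu => by
    rw [sc, ofComplex_apply_of_im_pos hu]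
  by_cases hint : |u₀.re| < 1 / 2 ∧ 1 / 3 < Complex.normSq (u₀ : ℂ)
  · have h1 : ∀ᶠ u in 𝓝 (u₀ : ℂ), |u.re| < 1 / 2 :=
      (continuous_abs.comp Complex.continuous_re).continuousAt.eventually
        (gt_mem_nhds (by simpa using hint.1))
    have h2 : ∀ᶠ u in 𝓝 (u₀ : ℂ), 1 / 3 < Complex.normSq u :=
      Complex.continuous_normSq.continuousAt.eventually (lt_mem_nhds hint.2)
    filter_upwards [hc_im, h1, h2] with u hu h1 h2
    have hu0 : 0 < u.im := lt_trans (by positivity) hu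
    refine ⟨hu, ofComplex u, mem_orbThree_self _, ⟨?_, ?_⟩, by rw [hsc u hu0]⟩
    · rw [show (ofComplex u).re = u.re by rw [← UpperHalfPlane.coe_re, ofComplex_apply_of_im_pos hu0]]
      exact h1.le
    · rw [ofComplex_apply_of_im_pos hu0]; exact h2.le
  · push Not at hint
    by_cases hre : |u₀.re| < 1 / 2
    · -- on the arc `normSq u₀ = 1/3`: use `W₃` when `normSq u < 1/3`
      have hn1 : Complex.normSq (u₀ : ℂ) = 1 / 3 := le_antisymm (hint hre) hn0
      have h1 : ∀ᶠ u in 𝓝 (u₀ : ℂ), |u.re| < 1 / 2 :=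
        (continuous_abs.comp Complex.continuous_re).continuousAt.eventually
          (gt_mem_nhds (by simpa using hre))
      -- `|Re(W₃ u)| = |Re u|/(3 normSq u) < 1/2` near `u₀`
      have h2 : ∀ᶠ u in 𝓝 (u₀ : ℂ), 2 * |u.re| < 3 * Complex.normSq u := by
        have hc : Continuous fun u : ℂ => 3 * Complex.normSq u - 2 * |u.re| := by fun_prop
        have h0 : 0 < 3 * Complex.normSq (u₀ : ℂ) - 2 * |(u₀ : ℂ).re| := by
          rw [hn1, UpperHalfPlane.coe_re]; linarith
        filter_upwards [hc.continuousAt.eventually (lt_mem_nhds h0)] with u hu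
        linarith
      have h3 : ∀ᶠ u in 𝓝 (u₀ : ℂ), 3 * Complex.normSq u < 2 * s3 * u.im := by
        have hc : Continuous fun u : ℂ => 2 * s3 * u.im - 3 * Complex.normSq u := by fun_prop
        have h0 : 0 < 2 * s3 * (u₀ : ℂ).im - 3 * Complex.normSq (u₀ : ℂ) := by
          rw [hn1, UpperHalfPlane.coe_im]
          rw [show Real.sqrt 3 = s3 from rfl] at him hs33 hs30
          nlinarith
        filter_upwards [hc.continuousAt.eventually (lt_mem_nhds h0)] with u hu
        linarith
      filter_upwards [hc_im, h1, h2, h3] with u hu h1 h2 h3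
      have hu0 : 0 < u.im := lt_trans (by positivity) hu
      have hcoe : ((ofComplex u : ℍ) : ℂ) = u := by rw [ofComplex_apply_of_im_pos hu0]
      refine ⟨hu, ?_⟩
      by_cases hn : 1 / 3 ≤ Complex.normSq u
      · refine ⟨ofComplex u, mem_orbThree_self _, ⟨?_, by rwa [hcoe]⟩, by rw [hsc u hu0]⟩
        rw [show (ofComplex u).re = u.re by rw [← UpperHalfPlane.coe_re, hcoe]]; exact h1.le
      · push Not at hn
        have hnpos : 0 < Complex.normSq u := Complex.normSq_pos.mpr (by rintro rfl; simp at hu0)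
        have hu0' : u ≠ 0 := by rintro rfl; simp at hu0
        have himU : (ofComplex u).im = u.im := by rw [← UpperHalfPlane.coe_im, hcoe]
        refine ⟨frickeThree (ofComplex u), frickeThree_mem_orbThree _, ⟨?_, ?_⟩, ?_⟩
        · rw [← UpperHalfPlane.coe_re, coe_frickeThree, hcoe]
          have e : (-1 / (3 * u)).re = -(1 / 3) * (u.re / Complex.normSq u) := by
            have : (-1 / (3 * u) : ℂ) = ((-(1 / 3) : ℝ) : ℂ) * u⁻¹ := by
              rw [div_eq_mul_inv, mul_inv]; push_cast; ring
            rw [this, Complex.re_ofReal_mul, Complex.inv_re]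
          have h3n : (0 : ℝ) < 3 * Complex.normSq u := by linarith
          rw [e, show -(1 / 3) * (u.re / Complex.normSq u) = -u.re / (3 * Complex.normSq u) by
            field_simp, abs_div, abs_neg, abs_of_pos h3n, div_le_iff₀ h3n]
          linarith
        · rw [normSq_frickeThree, hcoe]
          rw [le_div_iff₀ (by linarith), ← sub_nonneg]
          nlinarith
        · rw [sc_frickeThree, hsc u hu0]
          have hlens : (s3 : ℂ) * u ∈ dataThree.lens := by
            have := sc_mem_lens (u := ofComplex u) (by rw [himU]; exact hu) (by rw [hcoe, himU]; exact h3)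
            rwa [hsc u hu0] at this
          exact dataThree.Fbase_Sc hlens hreal
    · -- on a vertical side
      push Not at hre
      have hre12 : |u₀.re| = 1 / 2 := le_antisymm hre0 hre
      have hn1 : 1 / 3 < Complex.normSq (u₀ : ℂ) := by
        by_contra hcon
        push Not at hcon
        have hn1 : Complex.normSq (u₀ : ℂ) = 1 / 3 := le_antisymm hcon hn0
        have him2 : u₀.im ^ 2 = 1 / 12 := by
          rw [Complex.normSq_apply, UpperHalfPlane.coe_re, UpperHalfPlane.coe_im] at hn1
          have : u₀.re ^ 2 = 1 / 4 := by rw [← sq_abs, hre12]; norm_num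
          nlinarith [u₀.im_pos]
        have := (im_sq_gt_iff u₀).mpr him
        linarith
      rcases (abs_eq (by norm_num : (0:ℝ) ≤ 1/2)).mp hre12 with hr | hr
      · -- right side: use `T⁻¹` when `re u > 1/2`
        have h1 : ∀ᶠ u in 𝓝 (u₀ : ℂ), 0 < u.re ∧ u.re < 1 := by
          have e : (u₀ : ℂ).re = 1 / 2 := by rw [UpperHalfPlane.coe_re, hr]
          have ha := Complex.continuous_re.continuousAt.eventually (lt_mem_nhds (show (0:ℝ) < (u₀:ℂ).re by rw [e]; norm_num))
          have hb := Complex.continuous_re.continuousAt.eventually (gt_mem_nhds (show (u₀:ℂ).re < 1 by rw [e]; norm_num))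
          exact ha.and hb
        have h2 : ∀ᶠ u in 𝓝 (u₀ : ℂ), 1 / 3 < Complex.normSq u :=
          Complex.continuous_normSq.continuousAt.eventually (lt_mem_nhds hn1)
        have h3 : ∀ᶠ u in 𝓝 (u₀ : ℂ), 1 / 3 < Complex.normSq (u - 1) := by
          have hc : Continuous fun u : ℂ => Complex.normSq (u - 1) := by fun_prop
          have h0 : 1 / 3 < Complex.normSq ((u₀ : ℂ) - 1) := by
            have e : Complex.normSq ((u₀ : ℂ) - 1) = Complex.normSq (u₀ : ℂ) - 2 * u₀.re + 1 := by
              simp [Complex.normSq_apply]; ring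
            rw [e, hr]; linarith
          exact hc.continuousAt.eventually (lt_mem_nhds h0)
        filter_upwards [hc_im, h1, h2, h3] with u hu h1 h2 h3
        have hu0 : 0 < u.im := lt_trans (by positivity) hu
        have hcoe : ((ofComplex u : ℍ) : ℂ) = u := by rw [ofComplex_apply_of_im_pos hu0]
        refine ⟨hu, ?_⟩
        by_cases hru : u.re ≤ 1 / 2
        · refine ⟨ofComplex u, mem_orbThree_self _, ⟨?_, by rw [hcoe]; exact h2.le⟩, by rw [hsc u hu0]⟩
          rw [show (ofComplex u).re = u.re by rw [← UpperHalfPlane.coe_re, hcoe], abs_le]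
          exact ⟨by linarith [h1.1], hru⟩
        · push Not at hru
          refine ⟨(((-1 : ℤ) : ℝ)) +ᵥ ofComplex u, vadd_int_mem_orbThree _ _, ⟨?_, ?_⟩, ?_⟩
          · rw [UpperHalfPlane.vadd_re, show (ofComplex u).re = u.re by rw [← UpperHalfPlane.coe_re, hcoe], abs_le]
            push_cast
            exact ⟨by linarith, by linarith [h1.2]⟩
          · rw [UpperHalfPlane.coe_vadd, hcoe]; push_cast
            rw [show (-1 : ℂ) + u = u - 1 by ring]; exact h3.le
          · rw [sc_vadd, hsc u hu0]
            exact dataThree.Fbase_add_int_mul_per (w := (s3 : ℂ) * u)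
              (by rw [dataThree_a, Complex.mul_im]; simp; rw [show Real.sqrt 3 = s3 from rfl] at hu hs33; nlinarith [s3_pos]) (-1)
      · -- left side: use `T` when `re u < -1/2`
        have h1 : ∀ᶠ u in 𝓝 (u₀ : ℂ), -1 < u.re ∧ u.re < 0 := by
          have e : (u₀ : ℂ).re = -(1 / 2) := by rw [UpperHalfPlane.coe_re, hr]
          have ha := Complex.continuous_re.continuousAt.eventually (lt_mem_nhds (show (-1:ℝ) < (u₀:ℂ).re by rw [e]; norm_num))
          have hb := Complex.continuous_re.continuousAt.eventually (gt_mem_nhds (show (u₀:ℂ).re < 0 by rw [e]; norm_num))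
          exact ha.and hb
        have h2 : ∀ᶠ u in 𝓝 (u₀ : ℂ), 1 / 3 < Complex.normSq u :=
          Complex.continuous_normSq.continuousAt.eventually (lt_mem_nhds hn1)
        have h3 : ∀ᶠ u in 𝓝 (u₀ : ℂ), 1 / 3 < Complex.normSq (u + 1) := by
          have hc : Continuous fun u : ℂ => Complex.normSq (u + 1) := by fun_prop
          have h0 : 1 / 3 < Complex.normSq ((u₀ : ℂ) + 1) := by
            have e : Complex.normSq ((u₀ : ℂ) + 1) = Complex.normSq (u₀ : ℂ) + 2 * u₀.re + 1 := by
              simp [Complex.normSq_apply]; ring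
            rw [e, hr]; linarith
          exact hc.continuousAt.eventually (lt_mem_nhds h0)
        filter_upwards [hc_im, h1, h2, h3] with u hu h1 h2 h3
        have hu0 : 0 < u.im := lt_trans (by positivity) hu
        have hcoe : ((ofComplex u : ℍ) : ℂ) = u := by rw [ofComplex_apply_of_im_pos hu0]
        refine ⟨hu, ?_⟩
        by_cases hru : -(1 / 2) ≤ u.re
        · refine ⟨ofComplex u, mem_orbThree_self _, ⟨?_, by rw [hcoe]; exact h2.le⟩, by rw [hsc u hu0]⟩
          rw [show (ofComplex u).re = u.re by rw [← UpperHalfPlane.coe_re, hcoe], abs_le]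
          exact ⟨hru, by linarith [h1.2]⟩
        · push Not at hru
          refine ⟨(((1 : ℤ) : ℝ)) +ᵥ ofComplex u, vadd_int_mem_orbThree _ _, ⟨?_, ?_⟩, ?_⟩
          · rw [UpperHalfPlane.vadd_re, show (ofComplex u).re = u.re by rw [← UpperHalfPlane.coe_re, hcoe], abs_le]
            push_cast
            exact ⟨by linarith [h1.1], by linarith⟩
          · rw [UpperHalfPlane.coe_vadd, hcoe]; push_cast
            rw [show (1 : ℂ) + u = u + 1 by ring]; exact h3.le
          · rw [sc_vadd, hsc u hu0]
            exact dataThree.Fbase_add_int_mul_per (w := (s3 : ℂ) * u)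
              (by rw [dataThree_a, Complex.mul_im]; simp; rw [show Real.sqrt 3 = s3 from rfl] at hu hs33; nlinarith [s3_pos]) 1


omit hreal in
/-- The scaled Möbius chart `μ(w) = √3·(γ•w)`: holomorphic near `z`, with
`(Im z)²‖μ'(z)‖² = (Im μ(z))²`. [folklore] -/
theorem chart_smul_facts (γ : SL(2, ℤ)) (z : ℍ) :
    (∀ᶠ w in 𝓝 (z : ℂ), DifferentiableAt ℂ (fun w : ℂ => (s3 : ℂ) * ((γ • ofComplex w : ℍ) : ℂ)) w) ∧
      deriv (fun w : ℂ => (s3 : ℂ) * ((γ • ofComplex w : ℍ) : ℂ)) z =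
        (s3 : ℂ) * (1 / denom (γ : GL (Fin 2) ℝ) z ^ 2) ∧
      z.im ^ 2 * ‖(s3 : ℂ) * (1 / denom (γ : GL (Fin 2) ℝ) z ^ 2)‖ ^ 2 =
        (((s3 : ℂ) * ((γ • z : ℍ) : ℂ)).im) ^ 2 := by
  obtain ⟨hdiff, hderiv⟩ := GreenRho.moebius_facts γ z
  refine ⟨?_, ?_, ?_⟩
  · filter_upwards [hdiff] with w hw using hw.const_mul _
  · rw [deriv_const_mul _ hdiff.self_of_nhds, hderiv]
  · have hden : denom (γ : GL (Fin 2) ℝ) z ≠ 0 := UpperHalfPlane.denom_ne_zero _ z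
    have himu : ((s3 : ℂ) * ((γ • z : ℍ) : ℂ)).im = s3 * (z.im / Complex.normSq (denom (γ : GL (Fin 2) ℝ) z)) := by
      rw [Complex.mul_im, Complex.ofReal_re, Complex.ofReal_im, zero_mul, add_zero, UpperHalfPlane.coe_im,
        ModularGroup.im_smul_eq_div_normSq]
    rw [himu]
    have hnorm : ‖(s3 : ℂ) * (1 / denom (γ : GL (Fin 2) ℝ) z ^ 2)‖ ^ 2 =
        3 / Complex.normSq (denom (γ : GL (Fin 2) ℝ) z) ^ 2 := by
      rw [norm_mul, Complex.norm_real, Real.norm_eq_abs, abs_of_pos s3_pos, norm_div, norm_one, norm_pow,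
        Complex.normSq_eq_norm_sq, mul_pow, s3_sq]; ring
    rw [hnorm]
    have hn0 : Complex.normSq (denom (γ : GL (Fin 2) ℝ) z) ≠ 0 := by rwa [Ne, Complex.normSq_eq_zero]
    field_simp
    linarith [s3_sq]

omit hreal in
/-- The Fricke chart `κ(w) = −1/(3w)`: `ofComplex ∘ κ = W₃ ∘ ofComplex` on `ℍ`, holomorphic near
`z ∈ ℍ`, with derivative `1/(3z²)` and `(Im z)²‖κ'(z)‖² = (Im κ(z))²`. [folklore] -/
theorem kappa_facts (z : ℍ) :
    (∀ w : ℂ, 0 < w.im → ofComplex (-1 / (3 * w)) = frickeThree (ofComplex w)) ∧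
      (∀ᶠ w in 𝓝 (z : ℂ), DifferentiableAt ℂ (fun w : ℂ => -1 / (3 * w)) w) ∧
      HasDerivAt (fun w : ℂ => -1 / (3 * w)) (1 / (3 * (z : ℂ) ^ 2)) z ∧
      (-1 / (3 * (z : ℂ))) = ((frickeThree z : ℍ) : ℂ) ∧
      z.im ^ 2 * ‖1 / (3 * (z : ℂ) ^ 2)‖ ^ 2 = ((frickeThree z : ℍ).im) ^ 2 := by
  have hz : (z : ℂ) ≠ 0 := z.ne_zero
  have hd : ∀ w : ℂ, w ≠ 0 → HasDerivAt (fun w : ℂ => -1 / (3 * w)) (1 / (3 * w ^ 2)) w := by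
    intro w hw
    have := ((hasDerivAt_inv hw).const_mul (-(1 / 3 : ℂ)))
    refine (this.congr_of_eventuallyEq (Eventually.of_forall fun v => ?_)).congr_deriv ?_
    · show -1 / (3 * v) = -(1 / 3) * v⁻¹
      rw [div_eq_mul_inv, mul_inv]; ring
    · field_simp
  refine ⟨fun w hw => ?_, ?_, hd _ hz, by rw [coe_frickeThree], ?_⟩
  · apply UpperHalfPlane.ext
    have hw' : 0 < (-1 / (3 * w)).im := by
      have e : (-1 / (3 * w) : ℂ) = ((-(1 / 3) : ℝ) : ℂ) * w⁻¹ := by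
        rw [div_eq_mul_inv, mul_inv]; push_cast; ring
      rw [e, Complex.im_ofReal_mul, Complex.inv_im]
      have hn : 0 < Complex.normSq w := Complex.normSq_pos.mpr (by rintro rfl; simp at hw)
      have : -w.im / Complex.normSq w < 0 := div_neg_of_neg_of_pos (by linarith) hn
      nlinarith
    rw [ofComplex_apply_of_im_pos hw', coe_frickeThree, ofComplex_apply_of_im_pos hw]
  · filter_upwards [isOpen_ne.mem_nhds hz] with w hw using (hd w hw).differentiableAt
  · rw [im_frickeThree, norm_div, norm_one, norm_mul, norm_pow, Complex.normSq_eq_norm_sq]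
    have hn : ‖(z : ℂ)‖ ≠ 0 := norm_ne_zero_iff.mpr hz
    have h3 : ‖(3 : ℂ)‖ = 3 := by simp
    rw [h3]
    field_simp

/-- **`FThree` is `C²` and `(Im z)² Δ (FThree ∘ ofComplex)(z) = 2 FThree(z)` off the corner orbit.** [folklore] -/
theorem contDiffAt_laplacian_FThree {z : ℍ} (hz : z ∉ cornerOrb) :
    ContDiffAt ℝ 2 (fun w : ℂ => FThree (ofComplex w)) (z : ℂ) ∧
      realHypLaplacian FThree z = (2 : ℝ) * ((2 : ℝ) - 1) * FThree z := by
  set u₀ : ℍ := repThree z with hu₀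
  have hu₀fd : u₀ ∈ fdThree := repThree_mem_fdThree z
  have hu₀orb : u₀ ∈ orbThree z := repThree_mem_orbThree z
  have hu₀no : u₀ ∉ cornerOrb := fun h => hz ((mem_cornerOrb_iff_of_mem_orbThree hu₀orb).mp h)
  have hchart := FThree_ofComplex_eventuallyEq hreal hu₀fd hu₀no
  have him0 : Real.sqrt 3 / 6 < u₀.im := im_gt_of_mem_fdThree hu₀fd hu₀no
  obtain ⟨γ, hγ, hcase⟩ := hu₀orb
  -- Case A at a general base point `x` with `γ • x = u₀`
  have caseA : ∀ x : ℍ, γ • x = u₀ →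
      ((fun w : ℂ => FThree (ofComplex w)) =ᶠ[𝓝 (x : ℂ)]
        dataThree.Fbase ∘ fun w : ℂ => (s3 : ℂ) * ((γ • ofComplex w : ℍ) : ℂ)) ∧
      (∀ᶠ w in 𝓝 (x : ℂ), DifferentiableAt ℂ (fun w : ℂ => (s3 : ℂ) * ((γ • ofComplex w : ℍ) : ℂ)) w) ∧
      dataThree.a < ((s3 : ℂ) * ((γ • ofComplex (x : ℂ) : ℍ) : ℂ)).im ∧
      x.im ^ 2 * ‖deriv (fun w : ℂ => (s3 : ℂ) * ((γ • ofComplex w : ℍ) : ℂ)) x‖ ^ 2 =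
        (((s3 : ℂ) * ((γ • ofComplex (x : ℂ) : ℍ) : ℂ)).im) ^ 2 := by
    intro x hx
    obtain ⟨hdiff, hderiv, hiso⟩ := chart_smul_facts γ x
    have hμcont : ContinuousAt (fun w : ℂ => ((γ • ofComplex w : ℍ) : ℂ)) (x : ℂ) :=
      (GreenRho.moebius_facts γ x).1.self_of_nhds.continuousAt
    have hμx : ((γ • ofComplex (x : ℂ) : ℍ) : ℂ) = (u₀ : ℂ) := by simp [hx]
    refine ⟨?_, hdiff, ?_, ?_⟩
    · have h1 : ∀ᶠ w in 𝓝 (x : ℂ), FThree (ofComplex ((γ • ofComplex w : ℍ) : ℂ)) =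
          dataThree.Fbase ((s3 : ℂ) * ((γ • ofComplex w : ℍ) : ℂ)) := by
        have := hμcont.eventually (show ∀ᶠ u in 𝓝 ((γ • ofComplex (x : ℂ) : ℍ) : ℂ),
          FThree (ofComplex u) = dataThree.Fbase ((s3 : ℂ) * u) by rw [hμx]; exact hchart)
        exact this
      filter_upwards [h1] with w hw
      rw [Function.comp_apply, ← hw, ofComplex_apply, FThree_smul hreal hγ]
    · rw [hμx, dataThree_a]
      simp only [Complex.mul_im, Complex.ofReal_re, Complex.ofReal_im, zero_mul, add_zero, UpperHalfPlane.coe_im]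
      have hs33 : Real.sqrt 3 * Real.sqrt 3 = 3 := Real.mul_self_sqrt (by norm_num)
      rw [show Real.sqrt 3 = s3 from rfl] at him0 hs33
      nlinarith [s3_pos]
    · rw [hderiv]
      simpa only [ofComplex_apply] using hiso
  rcases hcase with h | h
  · obtain ⟨hloc, hμ, him, hiso⟩ := caseA z h.symm
    exact dataThree.laplacian_of_chart hloc hμ him hiso
  · -- Case B: `u₀ = γ • W₃ z`; compose the chart at `z' = W₃ z` with `κ`
    set z' : ℍ := frickeThree z with hz'
    obtain ⟨hloc₁, hμ₁, him₁, hiso₁⟩ := caseA z' h.symm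
    obtain ⟨hκof, hκdiff, hκd, hκz, hκiso⟩ := kappa_facts z
    set μ₁ : ℂ → ℂ := fun w => (s3 : ℂ) * ((γ • ofComplex w : ℍ) : ℂ) with hμ₁def
    set κ : ℂ → ℂ := fun w => -1 / (3 * w) with hκdef
    have hκz' : κ (z : ℂ) = (z' : ℂ) := hκz
    have hκcont : ContinuousAt κ (z : ℂ) := hκd.continuousAt
    have hloc : (fun w : ℂ => FThree (ofComplex w)) =ᶠ[𝓝 (z : ℂ)] dataThree.Fbase ∘ (μ₁ ∘ κ) := by
      have h1 : ∀ᶠ w in 𝓝 (z : ℂ), FThree (ofComplex (κ w)) = dataThree.Fbase (μ₁ (κ w)) := by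
        have := hκcont.eventually (show ∀ᶠ u in 𝓝 (κ (z : ℂ)), FThree (ofComplex u) = (dataThree.Fbase ∘ μ₁) u by
          rw [hκz']; exact hloc₁)
        exact this
      filter_upwards [h1, isOpen_upperHalfPlaneSet.mem_nhds z.im_pos] with w hw hwpos
      simp only [Function.comp_apply]
      rw [← hw, hκdef]
      simp only
      rw [hκof w hwpos, FThree_frickeThree hreal]
    have hμ : ∀ᶠ w in 𝓝 (z : ℂ), DifferentiableAt ℂ (μ₁ ∘ κ) w := by
      have h1 : ∀ᶠ w in 𝓝 (z : ℂ), DifferentiableAt ℂ μ₁ (κ w) :=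
        hκcont.eventually (show ∀ᶠ u in 𝓝 (κ (z : ℂ)), DifferentiableAt ℂ μ₁ u by rw [hκz']; exact hμ₁)
      filter_upwards [h1, hκdiff] with w h1 h2 using h1.comp w h2
    have hderiv : deriv (μ₁ ∘ κ) z = deriv μ₁ (z' : ℂ) * (1 / (3 * (z : ℂ) ^ 2)) := by
      have h1 : DifferentiableAt ℂ μ₁ (κ (z : ℂ)) := by rw [hκz']; exact hμ₁.self_of_nhds
      rw [deriv_comp (z : ℂ) h1 hκd.differentiableAt, hκd.deriv, hκz']
    refine dataThree.laplacian_of_chart hloc hμ ?_ ?_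
    · show dataThree.a < (μ₁ (κ (z : ℂ))).im
      rw [hκz']; exact him₁
    · show z.im ^ 2 * ‖deriv (μ₁ ∘ κ) (z : ℂ)‖ ^ 2 = ((μ₁ (κ (z : ℂ))).im) ^ 2
      rw [hderiv, hκz', norm_mul, mul_pow, ← hiso₁]
      have e : (z' : ℍ).im ^ 2 = z.im ^ 2 * ‖1 / (3 * (z : ℂ) ^ 2)‖ ^ 2 := by rw [hz']; exact hκiso.symm
      rw [e]; ring

end Regularity

/-! ## 5. The cusp bound and `IsResolventGreenLike 3 2 cmLevelThree FThree` -/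

section Cusp

variable (hreal : (dataThree.M₁ Complex.I).im = 0)
include hreal

/-- For `Im w ≥ 1`, `FThree w = Fbase(√3 (w + n))` with `|Re(w + n)| ≤ 1/2`. [folklore] -/
theorem FThree_eq_Fbase_translate {w : ℍ} (hw : 1 ≤ w.im) :
    ∃ n : ℤ, FThree w = dataThree.Fbase (sc (((n : ℝ)) +ᵥ w)) := by
  set n : ℤ := -⌊w.re + 1 / 2⌋ with hn
  have h1 : ((⌊w.re + 1 / 2⌋ : ℤ) : ℝ) ≤ w.re + 1 / 2 := Int.floor_le _
  have h2 : w.re + 1 / 2 < ((⌊w.re + 1 / 2⌋ : ℤ) : ℝ) + 1 := Int.lt_floor_add_one _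
  refine ⟨n, ?_⟩
  have hs32 : Real.sqrt 3 < 2 := s3_lt_two
  have hno : w ∉ cornerOrb := fun h => by have := im_le_of_mem_cornerOrb h; linarith
  apply FThree_eq_of_rep hreal hno (vadd_int_mem_orbThree w n)
  refine ⟨?_, ?_⟩
  · rw [UpperHalfPlane.vadd_re, hn, abs_le]; push_cast; constructor <;> linarith
  · rw [Complex.normSq_apply, UpperHalfPlane.coe_re, UpperHalfPlane.coe_im, UpperHalfPlane.vadd_im]
    nlinarith [sq_nonneg ((((n : ℝ)) +ᵥ w).re)]

/-- **High in the cusp**: `|FThree w| · Im w ≤ C` for `Im w ≥ √3`. [folklore] -/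
theorem exists_FThree_cusp_bound : ∃ C : ℝ, 0 ≤ C ∧ ∀ w : ℍ, s3 ≤ w.im → |FThree w| * w.im ≤ C := by
  obtain ⟨C, hC⟩ := dataThree.exists_Fbase_cusp_bound'
  refine ⟨max (C / s3) 0, le_max_right _ _, fun w hw => ?_⟩
  have hw1 : 1 ≤ w.im := le_trans one_lt_s3.le hw
  obtain ⟨n, hF⟩ := FThree_eq_Fbase_translate hreal hw1
  rw [hF]
  set v := sc (((n : ℝ)) +ᵥ w) with hv
  have hvim : v.im = s3 * w.im := by rw [hv, sc_im, UpperHalfPlane.vadd_im]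
  have hv2 : 2 ≤ v.im := by rw [hvim]; nlinarith [s3_mul_s3, s3_pos]
  have h := hC v hv2
  rw [hvim] at h
  refine le_trans ?_ (le_max_left _ _)
  rw [le_div_iff₀ s3_pos]
  calc |dataThree.Fbase v| * w.im * s3 = |dataThree.Fbase v| * (s3 * w.im) := by ring
    _ ≤ C := h

omit hreal in
/-- `z/3 ∈ ℍ`. [folklore] -/
def third (z : ℍ) : ℍ := ⟨(z : ℂ) / 3, by rw [Complex.div_ofNat_im]; exact div_pos z.im_pos three_pos⟩

omit hreal in
/-- `S • z = W₃(z/3)`. [folklore] -/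
theorem S_smul_eq_frickeThree_third (z : ℍ) : ModularGroup.S • z = frickeThree (third z) := by
  apply UpperHalfPlane.ext
  rw [UpperHalfPlane.modular_S_smul, coe_mk, coe_frickeThree]
  change (-(z : ℂ))⁻¹ = -1 / (3 * ((z : ℂ) / 3))
  have hz : (z : ℂ) ≠ 0 := z.ne_zero
  field_simp

omit hreal in
/-- `S⁻¹ • z = S • z`. [folklore] -/
theorem S_inv_smul (z : ℍ) : ModularGroup.S⁻¹ • z = ModularGroup.S • z := by
  have h : ModularGroup.S⁻¹ = -ModularGroup.S := by
    apply inv_eq_of_mul_eq_one_right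
    rw [mul_neg, EllipticCurves.ModularForms.S_mul_S, neg_neg]
  rw [h, ModularGroup.SL_neg_smul]

omit hreal in
/-- Bottom-left entries of `σS`, `σTS` and `σT⁻¹S`. [folklore] -/
theorem bottom_left_mul_S (σ : SL(2, ℤ)) :
    (σ * ModularGroup.S) 1 0 = σ 1 1 ∧ (σ * ModularGroup.T * ModularGroup.S) 1 0 = σ 1 0 + σ 1 1 ∧
      (σ * ModularGroup.T⁻¹ * ModularGroup.S) 1 0 = σ 1 1 - σ 1 0 := by
  refine ⟨?_, ?_, ?_⟩
  · show ((σ : Matrix (Fin 2) (Fin 2) ℤ) * ModularGroup.S) 1 0 = _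
    simp [Matrix.mul_apply, Fin.sum_univ_two, ModularGroup.S]
  · show ((σ : Matrix (Fin 2) (Fin 2) ℤ) * ModularGroup.T * ModularGroup.S) 1 0 = _
    simp [Matrix.mul_apply, Fin.sum_univ_two, ModularGroup.S, ModularGroup.T]
  · show ((σ : Matrix (Fin 2) (Fin 2) ℤ) * ((ModularGroup.T⁻¹ : SL(2, ℤ)) : Matrix (Fin 2) (Fin 2) ℤ) * ModularGroup.S) 1 0 = _
    simp [Matrix.mul_apply, Fin.sum_univ_two, ModularGroup.S, ModularGroup.T, Matrix.SpecialLinearGroup.coe_inv,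
      Matrix.adjugate_fin_two]
    ring

/-- **Coset reduction**: for every `σ ∈ SL₂(ℤ)` there is `w` with `Im w = Im z` and
`FThree(σ•z) ∈ {FThree w, FThree(w/3)}` (`SL₂(ℤ) = Γ₀(3){1, S⁻¹, S⁻¹T⁻¹, S⁻¹T}`, `S z = W₃(z/3)`). [folklore] -/
theorem FThree_coset_reduction (σ : SL(2, ℤ)) (z : ℍ) :
    ∃ w : ℍ, w.im = z.im ∧ (FThree (σ • z) = FThree w ∨ FThree (σ • z) = FThree (third w)) := by
  obtain ⟨hS, hTS, hT'S⟩ := bottom_left_mul_S σ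
  by_cases hc : (3 : ℤ) ∣ σ 1 0
  · exact ⟨z, rfl, Or.inl (FThree_smul hreal ((mem_Gamma0_three_iff σ).mpr hc) z)⟩
  · by_cases hd : (3 : ℤ) ∣ σ 1 1
    · -- `σ = (σS) S⁻¹`
      have hγ : σ * ModularGroup.S ∈ Gamma0 3 := by rw [mem_Gamma0_three_iff, hS]; exact hd
      refine ⟨z, rfl, Or.inr ?_⟩
      have e : σ = σ * ModularGroup.S * ModularGroup.S⁻¹ := by group
      rw [e, mul_smul, FThree_smul hreal hγ, S_inv_smul, S_smul_eq_frickeThree_third, FThree_frickeThree hreal]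
    · by_cases hcd : (3 : ℤ) ∣ σ 1 0 + σ 1 1
      · -- `σ = (σTS) S⁻¹ T⁻¹`
        have hγ : σ * ModularGroup.T * ModularGroup.S ∈ Gamma0 3 := by rw [mem_Gamma0_three_iff, hTS]; exact hcd
        refine ⟨ModularGroup.T⁻¹ • z, ?_, Or.inr ?_⟩
        · have := UpperHalfPlane.modular_T_zpow_smul z (-1)
          rw [zpow_neg_one] at this
          rw [this, UpperHalfPlane.vadd_im]
        have e : σ = σ * ModularGroup.T * ModularGroup.S * ModularGroup.S⁻¹ * ModularGroup.T⁻¹ := by group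
        rw [e, mul_smul, mul_smul, FThree_smul hreal hγ, S_inv_smul, S_smul_eq_frickeThree_third, FThree_frickeThree hreal]
      · -- `σ = (σT⁻¹S) S⁻¹ T`, using `3 ∣ d − c`
        have key : ∀ x y : ZMod 3, x ≠ 0 → y ≠ 0 → x + y ≠ 0 → y - x = 0 := by decide
        have hdc : (3 : ℤ) ∣ σ 1 1 - σ 1 0 := by
          have h := key (σ 1 0 : ZMod 3) (σ 1 1 : ZMod 3)
            (fun h0 => hc ((ZMod.intCast_zmod_eq_zero_iff_dvd _ 3).mp h0))
            (fun h0 => hd ((ZMod.intCast_zmod_eq_zero_iff_dvd _ 3).mp h0))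
            (fun h0 => hcd ((ZMod.intCast_zmod_eq_zero_iff_dvd _ 3).mp (by push_cast; exact h0)))
          exact (ZMod.intCast_zmod_eq_zero_iff_dvd _ 3).mp (by push_cast; exact h)
        have hγ : σ * ModularGroup.T⁻¹ * ModularGroup.S ∈ Gamma0 3 := by rw [mem_Gamma0_three_iff, hT'S]; exact hdc
        refine ⟨ModularGroup.T • z, ?_, Or.inr ?_⟩
        · rw [UpperHalfPlane.modular_T_smul, UpperHalfPlane.vadd_im]
        have e : σ = σ * ModularGroup.T⁻¹ * ModularGroup.S * ModularGroup.S⁻¹ * ModularGroup.T := by group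
        rw [e, mul_smul, mul_smul, FThree_smul hreal hγ, S_inv_smul, S_smul_eq_frickeThree_third, FThree_frickeThree hreal]

/-- **`FThree` has properties (a), (c) and `Γ₀(3)`-invariance:
`IsResolventGreenLike 3 2 cmLevelThree FThree`.** [cite: GrossZagier1986, §II.2] -/
theorem isResolventGreenLike_FThree : IsResolventGreenLike 3 2 cmLevelThree FThree where
  smul_eq γ hγ z := FThree_smul hreal hγ z
  contDiffAt z hz := (contDiffAt_laplacian_FThree hreal (fun h => hz ((mem_orbit_iff_mem_cornerOrb z).mpr h))).1
  laplacian_eq z hz := by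
    have := (contDiffAt_laplacian_FThree hreal (fun h => hz ((mem_orbit_iff_mem_cornerOrb z).mpr h))).2
    simpa using this
  cusp_bound σ := by
    obtain ⟨C, hC0, hC⟩ := exists_FThree_cusp_bound hreal
    refine ⟨3 * C, 3 * s3, fun z hz => ?_⟩
    simp only [show (2 - 1 : ℕ) = 1 from rfl, pow_one]
    obtain ⟨w, hwim, h | h⟩ := FThree_coset_reduction hreal σ z
    · rw [h, ← hwim]
      have := hC w (by rw [hwim]; linarith [s3_pos])
      nlinarith [abs_nonneg (FThree w), w.im_pos]
    · rw [h]
      have him : (third w).im = z.im / 3 := by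
        rw [← UpperHalfPlane.coe_im]; simp [third, Complex.div_ofNat_im, hwim]
      have := hC (third w) (by rw [him]; linarith)
      rw [him] at this
      linarith

end Cusp

/-! ## 6. The local expansion of `g₃` at the corner -/

section Singularity

open Literature.NumberTheory.EllipticCurves.ModularForms (analyticAt_comp_ofComplex)

/-- The corner as a complex number, `c₃' = (3 + i√3)/6`. [folklore] -/
def c₃' : ℂ := ((cmLevelThree : ℍ) : ℂ)

/-- `Im c₃' = √3/6`. [folklore] -/
theorem c₃'_im : c₃'.im = Real.sqrt 3 / 6 := by rw [c₃', UpperHalfPlane.coe_im, cmLevelThree_im]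

/-- `Re c₃' = 1/2`. [folklore] -/
theorem c₃'_re : c₃'.re = 1 / 2 := by rw [c₃', UpperHalfPlane.coe_re, cmLevelThree_re]

/-- `c₃' = ⟨1/2, √3/6⟩`. [folklore] -/
theorem c₃'_eq : c₃' = ⟨1 / 2, Real.sqrt 3 / 6⟩ := rfl

/-- `0 < Im c₃'`. [folklore] -/
theorem c₃'_im_pos : 0 < c₃'.im := by rw [c₃'_im]; positivity

/-- `ofComplex c₃' = cmLevelThree`. [folklore] -/
theorem ofComplex_c₃' : ofComplex c₃' = cmLevelThree := by rw [c₃']; exact ofComplex_apply cmLevelThree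

/-- The scaled corner `p₃ = √3 c₃'`, of height `a = 1/2`. [folklore] -/
def p₃ : ℂ := (s3 : ℂ) * c₃'

/-- `Im p₃ = 1/2 = a`. [folklore] -/
theorem p₃_im : p₃.im = dataThree.a := by
  rw [p₃, Complex.mul_im, Complex.ofReal_re, Complex.ofReal_im, c₃'_im, c₃'_re, dataThree_a,
    show Real.sqrt 3 = s3 from rfl]
  nlinarith [s3_mul_s3]

/-- `p₃ = sc cmLevelThree`. [folklore] -/
theorem p₃_eq_sc : p₃ = sc cmLevelThree := rfl

/-- `𝓟''(c₃) ≠ 0` (`= −3π²E₆(ρ)`, `E₆(ρ) = E₆(ρ − 1) > 0`). [folklore] -/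
theorem PE2_c₃'_ne_zero : PE2 c₃' ≠ 0 := by
  unfold c₃'
  rw [PE2_cmLevelThree, ← E₄_wPt_E₆_wPt.2]
  obtain ⟨him, hre⟩ := E₆_wPt_pos
  have hE : E₆ wPt ≠ 0 := fun h => by rw [h] at hre; simp at hre
  have hπ : (π : ℂ) ≠ 0 := by exact_mod_cast Real.pi_ne_zero
  exact mul_ne_zero (mul_ne_zero (by norm_num) (pow_ne_zero 2 hπ)) hE

/-- The leading coefficient in the scaled coordinate: `α₃ := 6Δ₃(c₃)/𝓟''(c₃) = 1/(4π²)`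
(`a₃ = 2Δ₃(c₃)/𝓟''(c₃) = 1/(12π²)` in the `z`-coordinate). [folklore] -/
def αThree : ℝ := 1 / (4 * π ^ 2)

/-- `αThree > 0`. [folklore] -/
theorem αThree_pos : 0 < αThree := by rw [αThree]; positivity

/-- **`α₃ = Δ₃(c₃)/(𝓟''(c₃)/6)`.** [folklore] -/
theorem αThree_eq : (αThree : ℂ) = deltaThree cmLevelThree / (PE2 c₃' / (2 * 3)) := by
  unfold c₃'
  rw [deltaThree_cmLevelThree_eq_PE2, αThree]
  have hπ : (π : ℂ) ≠ 0 := by exact_mod_cast Real.pi_ne_zero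
  have hP : PE2 ((cmLevelThree : ℍ) : ℂ) ≠ 0 := PE2_c₃'_ne_zero
  push_cast
  field_simp
  norm_num

/-- **Local structure of `g₃` at `p₃`**: `g₃(ζ) = α₃/(ζ−p₃)² + b/(ζ−p₃) + h(ζ)` near `p₃` in `ℍ`, with
`h` continuous at `p₃` (double zero of `𝓟(·/√3)` at `p₃`: `E = (ζ − p₃)²g₃`, `g₃(p₃) = E''(p₃)/2 = 𝓟''(c₃)/6`).
[folklore] -/
theorem gC_local_expansion : ∃ b : ℂ, ∃ h : ℂ → ℂ, ContinuousAt h p₃ ∧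
    ∀ᶠ ζ in 𝓝 p₃, ζ ≠ p₃ → 0 < ζ.im →
      dataThree.gC ζ = (αThree : ℂ) / (ζ - p₃) ^ 2 + b / (ζ - p₃) + h ζ := by
  have hs := s3C_ne_zero
  have hc : 0 < c₃'.im := c₃'_im_pos
  have hp3 : p₃ / s3 = c₃' := by rw [p₃]; field_simp
  have hp3im : 0 < p₃.im := by rw [p₃_im, dataThree_a]; norm_num
  -- `E(v) = 𝓟(v/√3)`, `Dl(v) = Δ₃(v/√3)`
  set E : ℂ → ℂ := fun v => (eisThree ∘ ofComplex) (v / s3) with hE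
  set Dl : ℂ → ℂ := fun v => (deltaThree ∘ ofComplex) (v / s3) with hDl
  have hlin : AnalyticAt ℂ (fun v : ℂ => v / s3) p₃ := (analyticAt_id.div analyticAt_const hs)
  have hEmd : MDiff eisThree := UpperHalfPlane.mdifferentiable_iff.mpr fun w hw =>
    (differentiableAt_eisThree hw).differentiableWithinAt
  have hDmd : MDiff deltaThree := UpperHalfPlane.mdifferentiable_iff.mpr fun w hw =>
    (differentiableAt_deltaThree hw).differentiableWithinAt
  have hEan : AnalyticAt ℂ E p₃ := by
    have h1 : AnalyticAt ℂ (eisThree ∘ ofComplex) (p₃ / s3) := by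
      rw [hp3, c₃']; exact analyticAt_comp_ofComplex hEmd cmLevelThree
    exact h1.comp_of_eq hlin rfl
  have hDan : AnalyticAt ℂ Dl p₃ := by
    have h1 : AnalyticAt ℂ (deltaThree ∘ ofComplex) (p₃ / s3) := by
      rw [hp3, c₃']; exact analyticAt_comp_ofComplex hDmd cmLevelThree
    exact h1.comp_of_eq hlin rfl
  have hE0 : E p₃ = 0 := by
    simp only [hE]; rw [hp3, Function.comp_apply, ofComplex_c₃', eisThree_cmLevelThree]
  -- first and second derivatives of `E` along `v ↦ v/√3`
  set E' : ℂ → ℂ := fun v => PE1 (v / s3) / s3 with hE'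
  have hEd : ∀ v : ℂ, 0 < v.im → HasDerivAt E (E' v) v := by
    intro v hv
    have hv' : 0 < (v / s3).im := by rw [Complex.div_ofReal_im]; exact div_pos hv s3_pos
    have h1 : HasDerivAt (eisThree ∘ ofComplex) (PE1 (v / s3)) (v / s3) := hasDerivAt_eisThree_ofComplex hv'
    have h2 : HasDerivAt (fun u : ℂ => u / s3) (1 / s3) v := by
      simpa using (hasDerivAt_id v).div_const (s3 : ℂ)
    have := h1.comp v h2
    refine (this.congr_of_eventuallyEq (Eventually.of_forall fun u => rfl)).congr_deriv ?_
    rw [hE']; field_simp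
  have hE'd : HasDerivAt E' (PE2 c₃' / (s3 * s3)) p₃ := by
    have h1 : HasDerivAt PE1 (PE2 (p₃ / s3)) (p₃ / s3) := hasDerivAt_PE1 (by rw [hp3]; exact hc)
    have h2 : HasDerivAt (fun u : ℂ => u / s3) (1 / s3) p₃ := by
      simpa using (hasDerivAt_id p₃).div_const (s3 : ℂ)
    have := (h1.comp p₃ h2).div_const (s3 : ℂ)
    refine (this.congr_of_eventuallyEq (Eventually.of_forall fun u => rfl)).congr_deriv ?_
    rw [hp3]; field_simp
  have hE'0 : E' p₃ = 0 := by
    have h0 : PE1 c₃' = 0 := PE1_cmLevelThree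
    simp only [hE']; rw [hp3, h0, zero_div]
  have hderivE : deriv E =ᶠ[𝓝 p₃] E' := by
    filter_upwards [(Complex.continuous_im.isOpen_preimage _ isOpen_Ioi).mem_nhds hp3im] with v hv
    exact (hEd v hv).deriv
  have hEd0 : deriv E p₃ = 0 := by rw [(hEd p₃ hp3im).deriv, hE'0]
  have hdd : deriv (deriv E) p₃ = PE2 c₃' / (s3 * s3) := by
    rw [Filter.EventuallyEq.deriv_eq hderivE]; exact hE'd.deriv
  -- `E = (ζ − p₃) g₁`, `g₁ = (ζ − p₃) g₃`
  set g₁ : ℂ → ℂ := dslope E p₃ with hg₁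
  have hg₁an : AnalyticAt ℂ g₁ p₃ := GreenRho.analyticAt_dslope hEan
  have hg₁0 : g₁ p₃ = 0 := by rw [hg₁, dslope_same, hEd0]
  have hEfac : ∀ ζ, E ζ = (ζ - p₃) * g₁ ζ := fun ζ => by
    have := sub_smul_dslope E p₃ ζ
    rw [smul_eq_mul, hE0, sub_zero] at this
    exact this.symm
  set g₃ : ℂ → ℂ := dslope g₁ p₃ with hg₃
  have hg₃an : AnalyticAt ℂ g₃ p₃ := GreenRho.analyticAt_dslope hg₁an
  have hg₁fac : ∀ ζ, g₁ ζ = (ζ - p₃) * g₃ ζ := fun ζ => by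
    have := sub_smul_dslope g₁ p₃ ζ
    rw [smul_eq_mul, hg₁0, sub_zero] at this
    exact this.symm
  -- `g₃(p₃) = E''(p₃)/2`
  have hg₃val : g₃ p₃ = PE2 c₃' / (s3 * s3) / 2 := by
    -- `deriv g₁ p₃ = g₃ p₃`; `E' = g₁ + (ζ − p₃) g₁'` near `p₃`, so `E''(p₃) = 2 g₁'(p₃)`
    have hg₃p : g₃ p₃ = deriv g₁ p₃ := by rw [hg₃, dslope_same]
    have hg₁diff : ∀ᶠ ζ in 𝓝 p₃, DifferentiableAt ℂ g₁ ζ := hg₁an.eventually_analyticAt.mono fun ζ h => h.differentiableAt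
    set G : ℂ → ℂ := deriv g₁ with hG
    have hGan : AnalyticAt ℂ G p₃ := hg₁an.deriv
    have hprod : ∀ᶠ ζ in 𝓝 p₃, HasDerivAt E (g₁ ζ + (ζ - p₃) * G ζ) ζ := by
      filter_upwards [hg₁diff] with ζ hζ
      have h1 : HasDerivAt (fun u : ℂ => (u - p₃) * g₁ u) (1 * g₁ ζ + (ζ - p₃) * G ζ) ζ :=
        ((hasDerivAt_id ζ).sub_const p₃).mul hζ.hasDerivAt
      have h2 : (fun u : ℂ => (u - p₃) * g₁ u) = E := funext fun u => (hEfac u).symm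
      rw [h2] at h1
      exact h1.congr_deriv (by ring)
    have hderivE' : deriv E =ᶠ[𝓝 p₃] fun ζ => g₁ ζ + (ζ - p₃) * G ζ := by
      filter_upwards [hprod] with ζ hζ using hζ.deriv
    have hsum : HasDerivAt (fun ζ => g₁ ζ + (ζ - p₃) * G ζ) (G p₃ + (1 * G p₃ + (p₃ - p₃) * deriv G p₃)) p₃ := by
      have h1 : HasDerivAt g₁ (G p₃) p₃ := hg₁an.differentiableAt.hasDerivAt
      have h2 : HasDerivAt (fun ζ : ℂ => (ζ - p₃) * G ζ) (1 * G p₃ + (p₃ - p₃) * deriv G p₃) p₃ :=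
        ((hasDerivAt_id p₃).sub_const p₃).mul hGan.differentiableAt.hasDerivAt
      exact h1.add h2
    have hdd' : deriv (deriv E) p₃ = 2 * G p₃ := by
      rw [Filter.EventuallyEq.deriv_eq hderivE', hsum.deriv]; ring
    rw [hg₃p]
    have : 2 * G p₃ = PE2 c₃' / (s3 * s3) := by rw [← hdd', hdd]
    linear_combination this / 2
  have hg₃ne : g₃ p₃ ≠ 0 := by
    rw [hg₃val]
    exact div_ne_zero (div_ne_zero PE2_c₃'_ne_zero (mul_ne_zero hs hs)) two_ne_zero
  set φ : ℂ → ℂ := fun ζ => Dl ζ / g₃ ζ with hφ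
  have hφan : AnalyticAt ℂ φ p₃ := hDan.div hg₃an hg₃ne
  have hφ0 : φ p₃ = αThree := by
    simp only [hφ]
    rw [hg₃val, αThree_eq, hDl]
    simp only [Function.comp_apply]
    rw [hp3, ofComplex_c₃']
    have h3 : (s3 : ℂ) * s3 = 3 := by exact_mod_cast s3_mul_s3
    rw [h3]
    ring
  set ψ₁ : ℂ → ℂ := dslope φ p₃ with hψ₁
  have hψ₁an : AnalyticAt ℂ ψ₁ p₃ := GreenRho.analyticAt_dslope hφan
  set ψ₂ : ℂ → ℂ := dslope ψ₁ p₃ with hψ₂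
  have hψ₂an : AnalyticAt ℂ ψ₂ p₃ := GreenRho.analyticAt_dslope hψ₁an
  refine ⟨ψ₁ p₃, ψ₂, hψ₂an.continuousAt, ?_⟩
  have hgnz : ∀ᶠ ζ in 𝓝 p₃, g₃ ζ ≠ 0 := hg₃an.continuousAt.eventually_ne hg₃ne
  filter_upwards [hgnz] with ζ hgζ hne hpos
  have h1 : φ ζ = αThree + (ζ - p₃) * ψ₁ ζ := by
    have := sub_smul_dslope φ p₃ ζ
    rw [smul_eq_mul, hφ0] at this
    linear_combination -this
  have h2 : ψ₁ ζ = ψ₁ p₃ + (ζ - p₃) * ψ₂ ζ := by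
    have := sub_smul_dslope ψ₁ p₃ ζ
    rw [smul_eq_mul] at this
    linear_combination -this
  have hsub : ζ - p₃ ≠ 0 := sub_ne_zero.mpr hne
  have hgC : dataThree.gC ζ = φ ζ / (ζ - p₃) ^ 2 := by
    rw [HeckeFormData.gC, dataThree_g, gThree, scaleDown_ofComplex hpos, fThree]
    have e4 : eisThree (ofComplex (ζ / s3)) = E ζ := rfl
    have eD : deltaThree (ofComplex (ζ / s3)) = Dl ζ := rfl
    rw [e4, eD, hEfac ζ, hg₁fac ζ, hφ]
    field_simp
  rw [hgC, h1, h2]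
  field_simp
  ring

/-- **`Fbase` near `p₃`**: `Fbase(u) = −2α₃ log‖u − p₃‖ + O(1)` on `Im u > a`. [folklore] -/
theorem Fbase_log_bound_three : ∃ K ε : ℝ, 0 < ε ∧ ∀ u : ℂ, ‖u - p₃‖ < ε → dataThree.a < u.im →
    |dataThree.Fbase u + 2 * αThree * Real.log ‖u - p₃‖| ≤ K := by
  obtain ⟨b, h, hcont, hexp⟩ := gC_local_expansion
  exact dataThree.Fbase_log_bound p₃_im hcont hexp

end Singularity

/-! ## 8. `#Stab_{Γ₀(3)}(c₃) = 6` -/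

section Stabilizer

/-- `3c₃'² = 3c₃' − 1` (`c₃'` is a root of `3x² − 3x + 1`). [folklore] -/
theorem c₃'_quad : 3 * c₃' * c₃' = 3 * c₃' - 1 := by
  have hs : Real.sqrt 3 * Real.sqrt 3 = 3 := Real.mul_self_sqrt (by norm_num)
  rw [c₃'_eq]; apply Complex.ext
  · simp [Complex.mul_re, Complex.mul_im]; nlinarith [hs]
  · simp [Complex.mul_re, Complex.mul_im]; ring

/-- **Fixed-point equation**: `g • c₃ = c₃ ↔ a = c + d ∧ 3b = −c`. [folklore] -/
theorem smul_cmLevelThree_eq_iff (g : SL(2, ℤ)) :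
    g • cmLevelThree = cmLevelThree ↔ g 0 0 = g 1 1 + g 1 0 ∧ 3 * g 0 1 = -g 1 0 := by
  have hρ : ((cmLevelThree : ℍ) : ℂ) = c₃' := rfl
  have hden : ((g 1 0 : ℤ) : ℂ) * c₃' + ((g 1 1 : ℤ) : ℂ) ≠ 0 := denom_int_ne_zero g cmLevelThree
  have him : c₃'.im ≠ 0 := c₃'_im_pos.ne'
  constructor
  · intro h
    have hc : ((g • cmLevelThree : ℍ) : ℂ) = c₃' := by rw [h, hρ]
    rw [coe_smul_eq, hρ, div_eq_iff hden] at hc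
    -- `3(a c₃ + b) = 3 c₃ (c c₃ + d)` and `3c₃² = 3c₃ − 1` give `(c + d − a)·3c₃ + (−c − 3b) = 0`
    have key : (((g 1 0 : ℤ) : ℂ) + (g 1 1 : ℤ) - (g 0 0 : ℤ)) * (3 * c₃') - ((g 1 0 : ℤ) + 3 * (g 0 1 : ℤ)) = 0 := by
      linear_combination -3 * hc - ((g 1 0 : ℤ) : ℂ) * c₃'_quad
    have him' := congrArg Complex.im key
    have hre := congrArg Complex.re key
    simp only [Complex.sub_im, Complex.sub_re, Complex.mul_im, Complex.mul_re, Complex.add_im, Complex.add_re,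
      Complex.intCast_re, Complex.intCast_im, Complex.re_ofNat, Complex.im_ofNat, Complex.zero_re, Complex.zero_im,
      zero_mul, mul_zero, sub_zero, add_zero] at him' hre
    have h1 : ((g 1 0 : ℤ) : ℝ) + (g 1 1 : ℤ) - (g 0 0 : ℤ) = 0 := by
      have : (((g 1 0 : ℤ) : ℝ) + (g 1 1 : ℤ) - (g 0 0 : ℤ)) * (3 * c₃'.im) = 0 := by linarith
      rcases mul_eq_zero.mp this with h | h
      · exact h
      · exfalso; apply him; linarith
    rw [h1] at hre
    simp at hre
    constructor
    · have : ((g 0 0 : ℤ) : ℝ) = (g 1 1 : ℤ) + (g 1 0 : ℤ) := by linarith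
      exact_mod_cast this
    · have : 3 * ((g 0 1 : ℤ) : ℝ) = -(g 1 0 : ℤ) := by linarith
      exact_mod_cast this
  · rintro ⟨ha, hb⟩
    apply UpperHalfPlane.ext
    rw [coe_smul_eq, hρ, ha, div_eq_iff hden]
    push_cast
    have hb' : ((g 0 1 : ℤ) : ℂ) = -(g 1 0 : ℤ) / 3 := by
      have : (3 : ℂ) * (g 0 1 : ℤ) = -(g 1 0 : ℤ) := by exact_mod_cast hb
      linear_combination this / 3
    rw [hb']
    linear_combination (-((g 1 0 : ℤ) : ℂ) / 3) * c₃'_quad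

/-- The solutions `(k, d)` of `3k² + 3kd + d² = 1`. [folklore] -/
def pairsThree : Finset (ℤ × ℤ) := {(0, 1), (0, -1), (1, -1), (1, -2), (-1, 1), (-1, 2)}

/-- Membership in `pairsThree`. [folklore] -/
theorem mem_pairsThree_iff (p : ℤ × ℤ) : p ∈ pairsThree ↔ 3 * p.1 ^ 2 + 3 * p.1 * p.2 + p.2 ^ 2 = 1 := by
  obtain ⟨k, d⟩ := p
  constructor
  · intro h
    simp only [pairsThree, Finset.mem_insert, Finset.mem_singleton, Prod.mk.injEq] at h
    rcases h with ⟨rfl, rfl⟩ | ⟨rfl, rfl⟩ | ⟨rfl, rfl⟩ | ⟨rfl, rfl⟩ | ⟨rfl, rfl⟩ | ⟨rfl, rfl⟩ <;> norm_num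
  · intro h
    simp only at h
    -- `4 = 3(2k + d)² + d²`
    have h4 : 3 * (2 * k + d) ^ 2 + d ^ 2 = 4 := by nlinarith
    have hd : d ^ 2 ≤ 4 := by nlinarith [sq_nonneg (2 * k + d)]
    have hkd : (2 * k + d) ^ 2 ≤ 1 := by nlinarith [sq_nonneg d]
    have hd1 : -2 ≤ d ∧ d ≤ 2 := by constructor <;> nlinarith
    have hkd1 : -1 ≤ 2 * k + d ∧ 2 * k + d ≤ 1 := by constructor <;> nlinarith
    have hk1 : -1 ≤ k ∧ k ≤ 1 := by constructor <;> omega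
    simp only [pairsThree, Finset.mem_insert, Finset.mem_singleton, Prod.mk.injEq]
    obtain ⟨hk1a, hk1b⟩ := hk1
    obtain ⟨hd2a, hd2b⟩ := hd1
    interval_cases k <;> interval_cases d <;> simp_all

/-- `#pairsThree = 6`. [folklore] -/
theorem card_pairsThree : pairsThree.card = 6 := by decide

/-- The matrix `(3k + d, −k; 3k, d)` of determinant `3k² + 3kd + d²`. [folklore] -/
def stabMatThree (p : ℤ × ℤ) (hp : 3 * p.1 ^ 2 + 3 * p.1 * p.2 + p.2 ^ 2 = 1) : SL(2, ℤ) :=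
  ⟨!![3 * p.1 + p.2, -p.1; 3 * p.1, p.2], by rw [Matrix.det_fin_two_of]; nlinarith [hp]⟩

/-- `stabMatThree p ∈ Γ₀(3)`. [folklore] -/
theorem stabMatThree_mem (p : ℤ × ℤ) (hp : 3 * p.1 ^ 2 + 3 * p.1 * p.2 + p.2 ^ 2 = 1) : stabMatThree p hp ∈ Gamma0 3 := by
  rw [mem_Gamma0_three_iff]
  show (3 : ℤ) ∣ (!![3 * p.1 + p.2, -p.1; 3 * p.1, p.2] : Matrix (Fin 2) (Fin 2) ℤ) 1 0
  simp

/-- **`#Stab_{Γ₀(3)}(c₃) = 6`.** [folklore] -/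
theorem card_stabilizer_cmLevelThree : Nat.card (MulAction.stabilizer (Gamma0 3) cmLevelThree) = 6 := by
  let e : MulAction.stabilizer (Gamma0 3) cmLevelThree ≃ {p : ℤ × ℤ // p ∈ pairsThree} :=
    { toFun := fun γ => ⟨(((γ : Gamma0 3) : SL(2, ℤ)) 1 0 / 3, ((γ : Gamma0 3) : SL(2, ℤ)) 1 1), by
        rw [mem_pairsThree_iff]
        have hγ := γ.2
        rw [MulAction.mem_stabilizer_iff] at hγ
        have hfix : ((γ : Gamma0 3) : SL(2, ℤ)) • cmLevelThree = cmLevelThree := hγ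
        obtain ⟨ha, hb⟩ := (smul_cmLevelThree_eq_iff _).mp hfix
        obtain ⟨k, hk⟩ := (mem_Gamma0_three_iff _).mp (γ : Gamma0 3).2
        have hdet := det_two_entries ((γ : Gamma0 3) : SL(2, ℤ))
        rw [ha, hk] at hdet
        simp only
        rw [hk, Int.mul_ediv_cancel_left _ (by norm_num : (3 : ℤ) ≠ 0)]
        have hb2 : ((γ : Gamma0 3) : SL(2, ℤ)) 0 1 = -k := by rw [hk] at hb; linarith
        rw [hb2] at hdet
        nlinarith [hdet]⟩
      invFun := fun p => ⟨⟨stabMatThree p.1 ((mem_pairsThree_iff _).mp p.2), stabMatThree_mem _ _⟩, by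
        rw [MulAction.mem_stabilizer_iff]
        have h := (smul_cmLevelThree_eq_iff (stabMatThree p.1 ((mem_pairsThree_iff _).mp p.2))).mpr
          (by simp [stabMatThree]; ring)
        exact h⟩
      left_inv := fun γ => by
        apply Subtype.ext; apply Subtype.ext
        have hγ := γ.2
        rw [MulAction.mem_stabilizer_iff] at hγ
        have hfix : ((γ : Gamma0 3) : SL(2, ℤ)) • cmLevelThree = cmLevelThree := hγ
        obtain ⟨ha, hb⟩ := (smul_cmLevelThree_eq_iff _).mp hfix
        obtain ⟨k, hk⟩ := (mem_Gamma0_three_iff _).mp (γ : Gamma0 3).2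
        have hb2 : ((γ : Gamma0 3) : SL(2, ℤ)) 0 1 = -k := by rw [hk] at hb; linarith
        have hk' : ((γ : Gamma0 3) : SL(2, ℤ)) 1 0 / 3 = k := by rw [hk, Int.mul_ediv_cancel_left _ (by norm_num : (3 : ℤ) ≠ 0)]
        ext i j
        fin_cases i <;> fin_cases j <;> simp [stabMatThree, ha, hb2, hk]
        ring
      right_inv := fun p => by
        apply Subtype.ext
        simp [stabMatThree] }
  rw [Nat.card_congr e, Nat.card_eq_fintype_card, Fintype.card_coe, card_pairsThree]

end Stabilizer

/-! ## 7. Representatives near the corner and the logarithmic singularity of `FThree` -/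

section NearCorner

/-- Numerical bounds `1.7 < √3 < 1.75`. [folklore] -/
theorem s3_bounds : (17 : ℝ) / 10 < s3 ∧ s3 < 7 / 4 := by
  constructor
  · nlinarith [s3_mul_s3, s3_pos]
  · nlinarith [s3_mul_s3, s3_pos]

/-- Position of a point `z` with `‖z − c₃'‖ < 1/20`: `9/20 < Re z < 11/20`, `7/30 < Im z < 7/20`,
and `|Im z − √3/6| < 1/20`. [folklore] -/
theorem near_corner_bounds {z : ℍ} (hδ : ‖(z : ℂ) - c₃'‖ < 1 / 20) :
    9 / 20 < z.re ∧ z.re < 11 / 20 ∧ 7 / 30 < z.im ∧ z.im < 7 / 20 ∧ z.im < s3 / 6 + 1 / 20 ∧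
      s3 / 6 - 1 / 20 < z.im := by
  obtain ⟨hlo, hhi⟩ := s3_bounds
  have hzim : |z.im - s3 / 6| < 1 / 20 := by
    have : ((z : ℂ) - c₃').im = z.im - s3 / 6 := by simp [c₃'_im, s3]
    rw [← this]; exact (Complex.abs_im_le_norm _).trans_lt hδ
  have hzre : |z.re - 1 / 2| < 1 / 20 := by
    have : ((z : ℂ) - c₃').re = z.re - 1 / 2 := by simp [c₃'_re]
    rw [← this]; exact (Complex.abs_re_le_norm _).trans_lt hδ
  obtain ⟨hzim1, hzim2⟩ := abs_lt.mp hzim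
  obtain ⟨hzre1, hzre2⟩ := abs_lt.mp hzre
  refine ⟨by linarith, by linarith, by linarith, by linarith, by linarith, by linarith⟩

set_option maxHeartbeats 3200000 in
/-- **The representatives near the corner.** If `‖z − c₃'‖ < 1/20`, `u ∈ Γ₀(3)⁺z` and
`Im u > √3/6`, then `u − n` is one of the six points `z`, `(2z−1)/(3z−1)`, `(z−1)/(3z−2)`, `(3z−1)/(3z)`,
`−1/(3(z−1))`, `(3z−2)/(3(2z−1))` (the images of `z` under the local group of order `6` at `c₃`,
normalised to lie near `c₃`). [folklore] -/
theorem rep_cases_near {z u : ℍ} (hδ : ‖(z : ℂ) - c₃'‖ < 1 / 20) (huz : u ∈ orbThree z)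
    (him : Real.sqrt 3 / 6 < u.im) :
    ∃ v : ℂ, (v = (z : ℂ) ∨ v = (2 * (z : ℂ) - 1) / (3 * z - 1) ∨ v = ((z : ℂ) - 1) / (3 * z - 2) ∨
      v = (3 * (z : ℂ) - 1) / (3 * z) ∨ v = -1 / (3 * ((z : ℂ) - 1)) ∨ v = (3 * (z : ℂ) - 2) / (3 * (2 * z - 1))) ∧
      ∃ n : ℤ, (u : ℂ) = v + n := by
  obtain ⟨hx1, hx2, hy1, hy2, hy3, hy4⟩ := near_corner_bounds hδ
  obtain ⟨hlo, hhi⟩ := s3_bounds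
  rw [show Real.sqrt 3 = s3 from rfl] at him
  have hz0 : (z : ℂ) ≠ 0 := z.ne_zero
  have hz31 : (3 : ℂ) * z - 1 ≠ 0 := by
    intro h; have := congrArg Complex.im h; simp at this; linarith [z.im_pos]
  have hz32 : (3 : ℂ) * z - 2 ≠ 0 := by
    intro h; have := congrArg Complex.im h; simp at this; linarith [z.im_pos]
  have hz1 : (z : ℂ) - 1 ≠ 0 := by
    intro h; have := congrArg Complex.im h; simp at this; linarith [z.im_pos]
  have hz21 : (2 : ℂ) * z - 1 ≠ 0 := by
    intro h; have := congrArg Complex.im h; simp at this; linarith [z.im_pos]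
  obtain ⟨γ, hγ, hcase⟩ := huz
  obtain ⟨k, hk⟩ := (mem_Gamma0_three_iff γ).mp hγ
  set a : ℤ := γ 0 0 with ha
  set b : ℤ := γ 0 1 with hb
  set d : ℤ := γ 1 1 with hd
  have hdet : a * d - b * (3 * k) = 1 := by have := det_two_entries γ; rw [hk] at this; exact this
  rcases hcase with rfl | rfl
  · -- Case 1: `u = γ • z`
    have hcoe : ((γ • z : ℍ) : ℂ) = ((a : ℂ) * z + (b : ℂ)) / ((((3 * k : ℤ)) : ℂ) * z + (d : ℂ)) := by
      rw [coe_smul_eq, hk]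
    have himu : (γ • z).im = z.im / Complex.normSq ((((3 * k : ℤ)) : ℂ) * z + (d : ℂ)) := by
      rw [im_smul_eq, hk]
    set N := Complex.normSq ((((3 * k : ℤ)) : ℂ) * z + (d : ℂ)) with hN
    have hNexp : N = (3 * (k : ℝ) * z.re + d) ^ 2 + 9 * (k : ℝ) ^ 2 * z.im ^ 2 := by
      rw [hN, Complex.normSq_apply]
      simp only [Complex.add_re, Complex.mul_re, Complex.intCast_re, Complex.intCast_im, zero_mul,
        sub_zero, UpperHalfPlane.coe_re, Complex.add_im, Complex.mul_im, add_zero, UpperHalfPlane.coe_im]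
      push_cast; ring
    have hN0 : 0 < N := by
      have hu0 := (γ • z).im_pos
      rw [himu] at hu0
      rcases div_pos_iff.mp hu0 with h | h
      · exact h.2
      · exact absurd z.im_pos (not_lt.mpr h.1.le)
    have hN1 : N < 6 / 5 := by
      rw [himu, lt_div_iff₀ hN0] at him
      by_contra hcon
      push Not at hcon
      have h2 : s3 / 6 * N < s3 / 6 + 1 / 20 := lt_trans him hy3
      have h3 : s3 / 5 ≤ s3 / 6 * N := by nlinarith [hcon, s3_pos]
      linarith
    have hNr : (3 * (k : ℝ) * z.re + d) ^ 2 + 9 * (k : ℝ) ^ 2 * z.im ^ 2 < 6 / 5 := by rw [← hNexp]; exact hN1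
    have hNpos : 0 < (3 * (k : ℝ) * z.re + d) ^ 2 + 9 * (k : ℝ) ^ 2 * z.im ^ 2 := by rw [← hNexp]; exact hN0
    -- integer constraints
    have hk_le : -1 ≤ k ∧ k ≤ 1 := by
      have h1 : 9 * (k : ℝ) ^ 2 * z.im ^ 2 < 6 / 5 := by nlinarith [sq_nonneg (3 * (k : ℝ) * z.re + d)]
      have h2 : (k : ℝ) ^ 2 < 3 := by nlinarith
      have h3 : k ^ 2 < 3 := by exact_mod_cast h2
      constructor <;> nlinarith
    have hk1 : k ^ 2 ≤ 1 := by nlinarith [hk_le.1, hk_le.2]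
    have hd_le : -2 ≤ d ∧ d ≤ 2 := by
      have hkr : (k : ℝ) ^ 2 ≤ 1 := by exact_mod_cast hk1
      have h1 : (3 * (k : ℝ) * z.re + d) ^ 2 < 6 / 5 := by nlinarith [sq_nonneg (k : ℝ), sq_nonneg z.im]
      have h4 : |3 * (k : ℝ) * z.re + d| < 11 / 10 := abs_lt_of_sq_lt_sq (by nlinarith) (by norm_num)
      have h5 : |3 * (k : ℝ) * z.re| ≤ 33 / 20 := by
        rw [abs_mul, abs_mul]
        have hk' : |(k : ℝ)| ≤ 1 := by rw [← sq_le_one_iff_abs_le_one]; exact hkr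
        have hz' : |z.re| ≤ 11 / 20 := by rw [abs_le]; constructor <;> linarith
        calc |(3:ℝ)| * |(k : ℝ)| * |z.re| ≤ 3 * 1 * (11 / 20) := by
              rw [abs_of_pos (by norm_num : (0:ℝ) < 3)]; gcongr
          _ = 33 / 20 := by norm_num
      have h3 : |(d : ℝ)| ≤ |3 * (k : ℝ) * z.re + d| + |3 * (k : ℝ) * z.re| := by
        have := abs_sub (3 * (k : ℝ) * z.re + d) (3 * (k : ℝ) * z.re)
        rwa [show 3 * (k : ℝ) * z.re + d - 3 * (k : ℝ) * z.re = d by ring] at this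
      have h6 : |(d : ℝ)| < 3 := by linarith
      obtain ⟨h6a, h6b⟩ := abs_lt.mp h6
      constructor
      · have : ((-3 : ℤ) : ℝ) < d := by push_cast; linarith
        have : (-3 : ℤ) < d := by exact_mod_cast this
        omega
      · have : (d : ℝ) < ((3 : ℤ) : ℝ) := by push_cast; linarith
        have : d < 3 := by exact_mod_cast this
        omega
    have hzn : 1 / 4 < z.re ^ 2 + z.im ^ 2 := by nlinarith
    obtain ⟨hk_a, hk_b⟩ := hk_le
    obtain ⟨hd_a, hd_b⟩ := hd_le
    -- the six admissible rows
    have hrows : (k = 0 ∧ (d = 1 ∨ d = -1)) ∨ (k = 1 ∧ d = -1) ∨ (k = -1 ∧ d = 1) ∨ (k = 1 ∧ d = -2) ∨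
        (k = -1 ∧ d = 2) := by
      interval_cases k <;> interval_cases d <;> push_cast at hNr hNpos <;> norm_num <;>
        nlinarith [hNr, hNpos, hx1, hx2, hy1, hy2, hzn, sq_nonneg z.re, sq_nonneg z.im]
    rcases hrows with ⟨hk0, hd1⟩ | ⟨hk0, hd0⟩ | ⟨hk0, hd0⟩ | ⟨hk0, hd0⟩ | ⟨hk0, hd0⟩
    · -- `k = 0`: translation
      refine ⟨(z : ℂ), Or.inl rfl, ?_⟩
      rw [hk0] at hcoe hdet
      rcases hd1 with hd0 | hd0 <;> rw [hd0] at hcoe hdet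
      · have ha1 : a = 1 := by linarith
        refine ⟨b, ?_⟩
        rw [hcoe, ha1]; push_cast; ring
      · have ha1 : a = -1 := by linarith
        refine ⟨-b, ?_⟩
        rw [hcoe, ha1]; push_cast; ring
    · -- `(c, d) = (3, −1)`
      rw [hk0, hd0] at hcoe hdet
      have ha1 : a = -1 - 3 * b := by linarith
      refine ⟨(2 * (z : ℂ) - 1) / (3 * z - 1), Or.inr (Or.inl rfl), -b - 1, ?_⟩
      have hden : (((3 * 1 : ℤ)) : ℂ) * z + ((-1 : ℤ) : ℂ) = 3 * z - 1 := by push_cast; ring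
      rw [hcoe, ha1, hden]; push_cast
      field_simp
      ring
    · -- `(c, d) = (−3, 1)`
      rw [hk0, hd0] at hcoe hdet
      have ha1 : a = 1 - 3 * b := by linarith
      refine ⟨(2 * (z : ℂ) - 1) / (3 * z - 1), Or.inr (Or.inl rfl), b - 1, ?_⟩
      have e : ((γ • z : ℍ) : ℂ) = ((((1 - 3 * b : ℤ)) : ℂ) * z + b) / (-(3 * (z : ℂ) - 1)) := by
        rw [hcoe, ha1]; congr 1; push_cast; ring
      rw [e, div_neg]
      push_cast
      field_simp
      ring
    · -- `(c, d) = (3, −2)`: `b` is odd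
      rw [hk0, hd0] at hcoe hdet
      obtain ⟨m, hm⟩ : ∃ m : ℤ, b + 1 = 2 * m := ⟨(b + 1) / 2, by omega⟩
      have ha1 : (a : ℂ) = -3 * m + 1 := by
        have : a = -3 * m + 1 := by omega
        exact_mod_cast this
      have hb1 : (b : ℂ) = 2 * m - 1 := by
        have : b = 2 * m - 1 := by omega
        exact_mod_cast this
      refine ⟨((z : ℂ) - 1) / (3 * z - 2), Or.inr (Or.inr (Or.inl rfl)), -m, ?_⟩
      have hden : (((3 * 1 : ℤ)) : ℂ) * z + ((-2 : ℤ) : ℂ) = 3 * z - 2 := by push_cast; ring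
      rw [hcoe, hden, ha1, hb1]
      push_cast
      field_simp
      ring
    · -- `(c, d) = (−3, 2)`: `b` is odd
      rw [hk0, hd0] at hcoe hdet
      obtain ⟨m, hm⟩ : ∃ m : ℤ, b - 1 = 2 * m := ⟨(b - 1) / 2, by omega⟩
      have ha1 : (a : ℂ) = -3 * m - 1 := by
        have : a = -3 * m - 1 := by omega
        exact_mod_cast this
      have hb1 : (b : ℂ) = 2 * m + 1 := by
        have : b = 2 * m + 1 := by omega
        exact_mod_cast this
      refine ⟨((z : ℂ) - 1) / (3 * z - 2), Or.inr (Or.inr (Or.inl rfl)), m, ?_⟩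
      have e : ((γ • z : ℍ) : ℂ) = ((-3 * (m : ℂ) - 1) * z + (2 * m + 1)) / (-(3 * (z : ℂ) - 2)) := by
        rw [hcoe, ha1, hb1]; congr 1; push_cast; ring
      rw [e, div_neg]
      field_simp
      ring
  · -- Case 2: `u = γ • W₃ z`
    set w : ℍ := frickeThree z with hw
    have hwcoe : ((w : ℍ) : ℂ) = -1 / (3 * (z : ℂ)) := by rw [hw, coe_frickeThree]
    have hcoe : ((γ • w : ℍ) : ℂ) = ((a : ℂ) * w + (b : ℂ)) / ((((3 * k : ℤ)) : ℂ) * w + (d : ℂ)) := by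
      rw [coe_smul_eq, hk]
    have himu : (γ • w).im = 3 * z.im / Complex.normSq (3 * ((d : ℤ) : ℂ) * z - (((3 * k : ℤ)) : ℂ)) := by
      rw [hw, im_smul_frickeThree_eq, hk]
    set M := Complex.normSq (3 * ((d : ℤ) : ℂ) * z - (((3 * k : ℤ)) : ℂ)) with hM
    have hMexp : M = 9 * (((d : ℝ) * z.re - k) ^ 2 + (d : ℝ) ^ 2 * z.im ^ 2) := by
      rw [hM, Complex.normSq_apply]
      simp only [Complex.sub_re, Complex.mul_re, Complex.intCast_re, Complex.intCast_im, Complex.re_ofNat,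
        Complex.im_ofNat, zero_mul, sub_zero, UpperHalfPlane.coe_re, Complex.sub_im, Complex.mul_im,
        add_zero, UpperHalfPlane.coe_im, mul_zero]
      push_cast; ring
    have hM0 : 0 < M := by
      have hu0 := (γ • w).im_pos
      rw [himu] at hu0
      rcases div_pos_iff.mp hu0 with h | h
      · exact h.2
      · exfalso; linarith [h.1, z.im_pos]
    have hM1 : M < 18 / 5 := by
      rw [himu, lt_div_iff₀ hM0] at him
      by_contra hcon
      push Not at hcon
      have h2 : s3 / 6 * M < 3 * (s3 / 6 + 1 / 20) := by linarith
      have h3 : 3 * s3 / 5 ≤ s3 / 6 * M := by nlinarith [hcon, s3_pos]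
      linarith
    have hMr : ((d : ℝ) * z.re - k) ^ 2 + (d : ℝ) ^ 2 * z.im ^ 2 < 2 / 5 := by rw [hMexp] at hM1; nlinarith
    have hMpos : 0 < ((d : ℝ) * z.re - k) ^ 2 + (d : ℝ) ^ 2 * z.im ^ 2 := by rw [hMexp] at hM0; nlinarith
    have hd_le : -2 ≤ d ∧ d ≤ 2 := by
      have h1 : (d : ℝ) ^ 2 * z.im ^ 2 < 2 / 5 := by nlinarith [sq_nonneg ((d : ℝ) * z.re - k)]
      have h2 : (d : ℝ) ^ 2 < 3 ^ 2 := by nlinarith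
      have h3 : |(d : ℝ)| < 3 := abs_lt_of_sq_lt_sq h2 (by norm_num)
      obtain ⟨h3a, h3b⟩ := abs_lt.mp h3
      constructor
      · have : ((-3 : ℤ) : ℝ) < d := by push_cast; linarith
        have : (-3 : ℤ) < d := by exact_mod_cast this
        omega
      · have : (d : ℝ) < ((3 : ℤ) : ℝ) := by push_cast; linarith
        have : d < 3 := by exact_mod_cast this
        omega
    have hk_le : -1 ≤ k ∧ k ≤ 1 := by
      have hdr : (d : ℝ) ^ 2 ≤ 4 := by
        have : d ^ 2 ≤ 4 := by nlinarith [hd_le.1, hd_le.2]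
        exact_mod_cast this
      have h1 : ((d : ℝ) * z.re - k) ^ 2 < 2 / 5 := by nlinarith [sq_nonneg (d : ℝ), sq_nonneg z.im]
      have h4 : |(d : ℝ) * z.re - k| < 7 / 10 := abs_lt_of_sq_lt_sq (by nlinarith) (by norm_num)
      have h5 : |(d : ℝ) * z.re| ≤ 11 / 10 := by
        rw [abs_mul]
        have hd' : |(d : ℝ)| ≤ 2 := abs_le_of_sq_le_sq (by nlinarith) (by norm_num)
        have hz' : |z.re| ≤ 11 / 20 := by rw [abs_le]; constructor <;> linarith
        calc |(d : ℝ)| * |z.re| ≤ 2 * (11 / 20) := by gcongr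
          _ = 11 / 10 := by norm_num
      have h3 : |(k : ℝ)| ≤ |(d : ℝ) * z.re| + |(d : ℝ) * z.re - k| := by
        have := abs_sub ((d : ℝ) * z.re) ((d : ℝ) * z.re - k)
        rwa [show (d : ℝ) * z.re - ((d : ℝ) * z.re - k) = k by ring] at this
      have h6 : |(k : ℝ)| < 2 := by linarith
      obtain ⟨h6a, h6b⟩ := abs_lt.mp h6
      constructor
      · have : ((-2 : ℤ) : ℝ) < k := by push_cast; linarith
        have : (-2 : ℤ) < k := by exact_mod_cast this
        omega
      · have : (k : ℝ) < ((2 : ℤ) : ℝ) := by push_cast; linarith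
        have : k < 2 := by exact_mod_cast this
        omega
    have hzn : 1 / 4 < z.re ^ 2 + z.im ^ 2 := by nlinarith
    obtain ⟨hk_a, hk_b⟩ := hk_le
    obtain ⟨hd_a, hd_b⟩ := hd_le
    have hrows : (k = 0 ∧ (d = 1 ∨ d = -1)) ∨ (k = 1 ∧ d = 1) ∨ (k = -1 ∧ d = -1) ∨ (k = 1 ∧ d = 2) ∨
        (k = -1 ∧ d = -2) := by
      interval_cases k <;> interval_cases d <;> push_cast at hMr hMpos <;> norm_num <;>
        nlinarith [hMr, hMpos, hx1, hx2, hy1, hy2, hzn, sq_nonneg z.re, sq_nonneg z.im]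
    rcases hrows with ⟨hk0, hd1'⟩ | ⟨hk0, hd0⟩ | ⟨hk0, hd0⟩ | ⟨hk0, hd0⟩ | ⟨hk0, hd0⟩
    · refine ⟨(3 * (z : ℂ) - 1) / (3 * z), Or.inr (Or.inr (Or.inr (Or.inl rfl))), ?_⟩
      rw [hk0] at hcoe hdet
      rcases hd1' with hd0 | hd0 <;> rw [hd0] at hcoe hdet
      · have ha1 : a = 1 := by linarith
        refine ⟨b - 1, ?_⟩
        have hden : (((3 * 0 : ℤ)) : ℂ) * (w : ℂ) + ((1 : ℤ) : ℂ) = 1 := by push_cast; ring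
        rw [hcoe, hden, ha1, hwcoe]; push_cast
        field_simp
        ring
      · have ha1 : a = -1 := by linarith
        refine ⟨-b - 1, ?_⟩
        have hden : (((3 * 0 : ℤ)) : ℂ) * (w : ℂ) + ((-1 : ℤ) : ℂ) = -1 := by push_cast; ring
        rw [hcoe, hden, ha1, hwcoe]; push_cast
        field_simp
        ring
    · -- `(c, d) = (3, 1)`: `u = −1/(3(z−1)) + b`
      rw [hk0, hd0] at hcoe hdet
      have ha1 : a = 1 + 3 * b := by linarith
      refine ⟨-1 / (3 * ((z : ℂ) - 1)), Or.inr (Or.inr (Or.inr (Or.inr (Or.inl rfl)))), b, ?_⟩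
      have hden : (((3 * 1 : ℤ)) : ℂ) * (w : ℂ) + ((1 : ℤ) : ℂ) = ((z : ℂ) - 1) / z := by
        rw [hwcoe]; push_cast; field_simp; ring
      rw [hcoe, hden, ha1, hwcoe]; push_cast
      field_simp
      ring
    · -- `(c, d) = (−3, −1)`
      rw [hk0, hd0] at hcoe hdet
      have ha1 : a = 3 * b - 1 := by linarith
      refine ⟨-1 / (3 * ((z : ℂ) - 1)), Or.inr (Or.inr (Or.inr (Or.inr (Or.inl rfl)))), -b, ?_⟩
      have hden : (((3 * (-1) : ℤ)) : ℂ) * (w : ℂ) + ((-1 : ℤ) : ℂ) = -(((z : ℂ) - 1) / z) := by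
        rw [hwcoe]; push_cast; field_simp; ring
      rw [hcoe, hden, ha1, hwcoe, div_neg]; push_cast
      field_simp
      ring
    · -- `(c, d) = (3, 2)`: `b` odd
      rw [hk0, hd0] at hcoe hdet
      obtain ⟨m, hm⟩ : ∃ m : ℤ, b - 1 = 2 * m := ⟨(b - 1) / 2, by omega⟩
      have ha1 : (a : ℂ) = 3 * m + 2 := by
        have : a = 3 * m + 2 := by omega
        exact_mod_cast this
      have hb1 : (b : ℂ) = 2 * m + 1 := by
        have : b = 2 * m + 1 := by omega
        exact_mod_cast this
      refine ⟨(3 * (z : ℂ) - 2) / (3 * (2 * z - 1)), Or.inr (Or.inr (Or.inr (Or.inr (Or.inr rfl)))), m, ?_⟩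
      have hden : (((3 * 1 : ℤ)) : ℂ) * (w : ℂ) + ((2 : ℤ) : ℂ) = (2 * (z : ℂ) - 1) / z := by
        rw [hwcoe]; push_cast; field_simp; ring
      rw [hcoe, hden, ha1, hb1, hwcoe]
      field_simp
      ring
    · -- `(c, d) = (−3, −2)`: `b` odd
      rw [hk0, hd0] at hcoe hdet
      obtain ⟨m, hm⟩ : ∃ m : ℤ, b + 1 = 2 * m := ⟨(b + 1) / 2, by omega⟩
      have ha1 : (a : ℂ) = 3 * m - 2 := by
        have : a = 3 * m - 2 := by omega
        exact_mod_cast this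
      have hb1 : (b : ℂ) = 2 * m - 1 := by
        have : b = 2 * m - 1 := by omega
        exact_mod_cast this
      refine ⟨(3 * (z : ℂ) - 2) / (3 * (2 * z - 1)), Or.inr (Or.inr (Or.inr (Or.inr (Or.inr rfl)))), -m, ?_⟩
      have hden : (((3 * (-1) : ℤ)) : ℂ) * (w : ℂ) + ((-2 : ℤ) : ℂ) = -((2 * (z : ℂ) - 1) / z) := by
        rw [hwcoe]; push_cast; field_simp; ring
      rw [hcoe, hden, ha1, hb1, hwcoe, div_neg]
      push_cast
      field_simp
      ring

/-- Möbius difference identity. [folklore] -/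
theorem moebius_sub {A B C D z c : ℂ} (hz : C * z + D ≠ 0) (hc : C * c + D ≠ 0) :
    (A * z + B) / (C * z + D) - (A * c + B) / (C * c + D) = (A * D - B * C) * (z - c) / ((C * z + D) * (C * c + D)) := by
  rw [div_sub_div _ _ hz hc]
  congr 1
  ring

/-- **Comparability for a Möbius map fixing `c₃'`**: if `v = (Az+B)/(Cz+D)` with `AD − BC = t ∈ [1, 3]`,
`(Ac₃' + B) = c₃'(Cc₃' + D)`, `‖Cc₃' + D‖² = t` and `‖C‖ ≤ 6`, then for `‖z − c₃'‖ < 1/20`: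
`‖v − c₃'‖ ≤ 2‖z − c₃'‖` and `‖z − c₃'‖ ≤ 2‖v − c₃'‖`. [folklore] -/
theorem dist_comparable_of_moebius {A B C D : ℂ} {t : ℝ} (hdet : A * D - B * C = t) (ht : 1 ≤ t) (_ht3 : t ≤ 3)
    (hfix : A * c₃' + B = c₃' * (C * c₃' + D)) (hnorm : ‖C * c₃' + D‖ ^ 2 = t) (hC : ‖C‖ ≤ 6)
    {z : ℂ} (hδ : ‖z - c₃'‖ < 1 / 20) (hz : C * z + D ≠ 0) :
    ‖(A * z + B) / (C * z + D) - c₃'‖ ≤ 2 * ‖z - c₃'‖ ∧ ‖z - c₃'‖ ≤ 2 * ‖(A * z + B) / (C * z + D) - c₃'‖ := by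
  have hc0 : C * c₃' + D ≠ 0 := by
    intro h; rw [h, norm_zero] at hnorm; linarith [sq_nonneg (0:ℝ)]
  have hcfix : (A * c₃' + B) / (C * c₃' + D) = c₃' := by rw [hfix, mul_div_assoc, div_self hc0, mul_one]
  have hsub := moebius_sub (A := A) (B := B) hz hc0
  rw [hcfix, hdet] at hsub
  set r := ‖C * c₃' + D‖ with hr
  have hr0 : 0 < r := norm_pos_iff.mpr hc0
  have hr2 : r ^ 2 = t := hnorm
  have hr1 : 1 ≤ r := by nlinarith
  have hrt : r ≤ t := by nlinarith
  have hdiff : ‖(C * z + D) - (C * c₃' + D)‖ ≤ 6 * ‖z - c₃'‖ := by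
    rw [show (C * z + D) - (C * c₃' + D) = C * (z - c₃') by ring, norm_mul]
    exact mul_le_mul_of_nonneg_right hC (norm_nonneg _)
  have hlow : r - 6 / 20 ≤ ‖C * z + D‖ := by
    have := norm_sub_norm_le (C * c₃' + D) (C * z + D)
    rw [norm_sub_rev] at this
    linarith [hdiff]
  have hupp : ‖C * z + D‖ ≤ r + 6 / 20 := by
    have := norm_sub_norm_le (C * z + D) (C * c₃' + D)
    linarith [hdiff]
  have hpos : 0 < ‖C * z + D‖ := by linarith
  have hkey : ‖(A * z + B) / (C * z + D) - c₃'‖ = t * ‖z - c₃'‖ / (‖C * z + D‖ * r) := by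
    rw [hsub, norm_div, norm_mul, norm_mul, Complex.norm_real, Real.norm_eq_abs, abs_of_pos (by linarith)]
  rw [hkey]
  constructor
  · rw [div_le_iff₀ (mul_pos hpos hr0)]
    have : t ≤ 2 * (‖C * z + D‖ * r) := by nlinarith
    nlinarith [norm_nonneg (z - c₃')]
  · rw [show 2 * (t * ‖z - c₃'‖ / (‖C * z + D‖ * r)) = (2 * t * ‖z - c₃'‖) / (‖C * z + D‖ * r) by ring,
      le_div_iff₀ (mul_pos hpos hr0)]
    have : ‖C * z + D‖ * r ≤ 2 * t := by nlinarith
    nlinarith [norm_nonneg (z - c₃')]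

/-- Numerical facts about `c₃'` for the six maps: `‖Cc₃' + D‖²`. [folklore] -/
theorem c₃'_facts :
    ‖(3 : ℂ) * c₃' + (-1)‖ ^ 2 = 1 ∧ ‖(3 : ℂ) * c₃' + (-2)‖ ^ 2 = 1 ∧ ‖(3 : ℂ) * c₃' + 0‖ ^ 2 = 3 ∧
      ‖(3 : ℂ) * c₃' + (-3)‖ ^ 2 = 3 ∧ ‖(6 : ℂ) * c₃' + (-3)‖ ^ 2 = 3 := by
  have hs : Real.sqrt 3 * Real.sqrt 3 = 3 := Real.mul_self_sqrt (by norm_num)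
  simp only [← Complex.normSq_eq_norm_sq, c₃'_eq]
  refine ⟨?_, ?_, ?_, ?_, ?_⟩ <;>
  · simp [Complex.normSq_apply]; nlinarith [hs]

/-- **Distances of the six representatives to the corner** are comparable to `‖z − c₃'‖`. [folklore] -/
theorem rep_dist_comparable {z : ℍ} (hδ : ‖(z : ℂ) - c₃'‖ < 1 / 20) {v : ℂ}
    (hv : v = (z : ℂ) ∨ v = (2 * (z : ℂ) - 1) / (3 * z - 1) ∨ v = ((z : ℂ) - 1) / (3 * z - 2) ∨
      v = (3 * (z : ℂ) - 1) / (3 * z) ∨ v = -1 / (3 * ((z : ℂ) - 1)) ∨ v = (3 * (z : ℂ) - 2) / (3 * (2 * z - 1))) :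
    ‖v - c₃'‖ ≤ 2 * ‖(z : ℂ) - c₃'‖ ∧ ‖(z : ℂ) - c₃'‖ ≤ 2 * ‖v - c₃'‖ := by
  obtain ⟨n1, n2, n3, n4, n5⟩ := c₃'_facts
  have hq := c₃'_quad
  have hz0 : (z : ℂ) ≠ 0 := z.ne_zero
  have hz31 : (3 : ℂ) * z + (-1) ≠ 0 := by
    intro h; have := congrArg Complex.im h; simp at this; linarith [z.im_pos]
  have hz32 : (3 : ℂ) * z + (-2) ≠ 0 := by
    intro h; have := congrArg Complex.im h; simp at this; linarith [z.im_pos]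
  have hz30 : (3 : ℂ) * z + 0 ≠ 0 := by simpa using hz0
  have hz33 : (3 : ℂ) * z + (-3) ≠ 0 := by
    intro h; have := congrArg Complex.im h; simp at this; linarith [z.im_pos]
  have hz63 : (6 : ℂ) * z + (-3) ≠ 0 := by
    intro h; have := congrArg Complex.im h; simp at this; linarith [z.im_pos]
  have h3 : ‖(3 : ℂ)‖ ≤ 6 := by simp; norm_num
  have h6 : ‖(6 : ℂ)‖ ≤ 6 := by simp
  rcases hv with rfl | rfl | rfl | rfl | rfl | rfl
  · constructor <;> linarith [norm_nonneg ((z : ℂ) - c₃')]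
  · have h := dist_comparable_of_moebius (A := 2) (B := -1) (C := 3) (D := -1) (t := 1) (by norm_num) le_rfl (by norm_num)
      (by linear_combination -hq) n1 h3 hδ hz31
    rwa [show ((2 : ℂ) * z + -1) / (3 * z + -1) = (2 * (z : ℂ) - 1) / (3 * z - 1) by ring_nf] at h
  · have h := dist_comparable_of_moebius (A := 1) (B := -1) (C := 3) (D := -2) (t := 1) (by norm_num) le_rfl (by norm_num)
      (by linear_combination -hq) n2 h3 hδ hz32
    rwa [show ((1 : ℂ) * z + -1) / (3 * z + -2) = ((z : ℂ) - 1) / (3 * z - 2) by ring_nf] at h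
  · have h := dist_comparable_of_moebius (A := 3) (B := -1) (C := 3) (D := 0) (t := 3) (by norm_num) (by norm_num) le_rfl
      (by linear_combination -hq) n3 h3 hδ hz30
    rwa [show ((3 : ℂ) * z + -1) / (3 * z + 0) = (3 * (z : ℂ) - 1) / (3 * z) by ring_nf] at h
  · have h := dist_comparable_of_moebius (A := 0) (B := -1) (C := 3) (D := -3) (t := 3) (by norm_num) (by norm_num) le_rfl
      (by linear_combination -hq) n4 h3 hδ hz33
    rwa [show ((0 : ℂ) * z + -1) / (3 * z + -3) = -1 / (3 * ((z : ℂ) - 1)) by ring_nf] at h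
  · have h := dist_comparable_of_moebius (A := 3) (B := -2) (C := 6) (D := -3) (t := 3) (by norm_num) (by norm_num) le_rfl
      (by linear_combination -2 * hq) n5 h6 hδ hz63
    rwa [show ((3 : ℂ) * z + -2) / (6 * z + -3) = (3 * (z : ℂ) - 2) / (3 * (2 * z - 1)) by ring_nf] at h

/-- **The logarithmic singularity of `FThree` at `c₃`**:
`FThree(z) = −2α₂ log‖z − c₃'‖ + O(1)` for `z` off the orbit near `c₃`. [folklore] -/
theorem FThree_log_bound : ∃ C ε : ℝ, 0 < ε ∧ ∀ z : ℍ, z ∉ MulAction.orbit (Gamma0 3) cmLevelThree →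
    ‖(z : ℂ) - c₃'‖ < ε → |FThree z + 2 * αThree * Real.log ‖(z : ℂ) - c₃'‖| ≤ C := by
  obtain ⟨K, ε₁, hε₁, hK⟩ := Fbase_log_bound_three
  refine ⟨K + 2 * αThree * (2 * Real.log 2), min (1 / 20) (ε₁ / 4), lt_min (by norm_num) (by linarith),
    fun z hz hd => ?_⟩
  have hd1 : ‖(z : ℂ) - c₃'‖ < 1 / 20 := lt_of_lt_of_le hd (min_le_left _ _)
  have hd2 : ‖(z : ℂ) - c₃'‖ < ε₁ / 4 := lt_of_lt_of_le hd (min_le_right _ _)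
  have hzno : z ∉ cornerOrb := fun h => hz ((mem_orbit_iff_mem_cornerOrb z).mpr h)
  set u := repThree z with hu
  have hufd : u ∈ fdThree := repThree_mem_fdThree z
  have huorb : u ∈ orbThree z := repThree_mem_orbThree z
  have huno : u ∉ cornerOrb := fun h => hzno ((mem_cornerOrb_iff_of_mem_orbThree huorb).mp h)
  have huim : Real.sqrt 3 / 6 < u.im := im_gt_of_mem_fdThree hufd huno
  have hF : FThree z = dataThree.Fbase (sc u) := by rw [FThree, if_neg hzno]
  obtain ⟨v, hv, n, hn⟩ := rep_cases_near hd1 huorb huim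
  obtain ⟨hc1, hc2⟩ := rep_dist_comparable hd1 hv
  have hvim : Real.sqrt 3 / 6 < v.im := by
    have : u.im = v.im := by rw [← UpperHalfPlane.coe_im, hn]; simp
    rw [← this]; exact huim
  have hva : dataThree.a < ((s3 : ℂ) * v).im := by
    rw [dataThree_a, Complex.mul_im]; simp
    rw [show Real.sqrt 3 = s3 from rfl] at hvim
    nlinarith [s3_pos, s3_mul_s3]
  -- `FThree z = Fbase(√3 v)`
  have hF' : FThree z = dataThree.Fbase ((s3 : ℂ) * v) := by
    rw [hF, sc, hn, show (s3 : ℂ) * (v + n) = (s3 : ℂ) * v + n * dataThree.per by rw [dataThree_per]; ring]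
    exact dataThree.Fbase_add_int_mul_per hva n
  have hzne : (z : ℂ) - c₃' ≠ 0 := by
    intro h
    have : z = cmLevelThree := by apply UpperHalfPlane.ext; rw [sub_eq_zero] at h; rw [h, c₃']
    exact hz (this ▸ MulAction.mem_orbit_self _)
  have hzpos : 0 < ‖(z : ℂ) - c₃'‖ := norm_pos_iff.mpr hzne
  have hvpos : 0 < ‖v - c₃'‖ := by linarith
  -- apply the `Fbase` bound at `w = √3 v`
  have hw : (s3 : ℂ) * v - p₃ = (s3 : ℂ) * (v - c₃') := by rw [p₃]; ring
  have hwn : ‖(s3 : ℂ) * v - p₃‖ = s3 * ‖v - c₃'‖ := by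
    rw [hw, norm_mul, Complex.norm_real, Real.norm_eq_abs, abs_of_pos s3_pos]
  have hKv := hK ((s3 : ℂ) * v) (by rw [hwn]; nlinarith [s3_lt_two]) hva
  rw [hF', hwn] at *
  have hlog : |Real.log (s3 * ‖v - c₃'‖) - Real.log ‖(z : ℂ) - c₃'‖| ≤ 2 * Real.log 2 := by
    rw [Real.log_mul s3_pos.ne' hvpos.ne']
    have hs3 : 0 < Real.log s3 ∧ Real.log s3 < Real.log 2 :=
      ⟨Real.log_pos one_lt_s3, Real.log_lt_log s3_pos s3_lt_two⟩
    have hlog2 : |Real.log ‖v - c₃'‖ - Real.log ‖(z : ℂ) - c₃'‖| ≤ Real.log 2 := by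
      rw [← Real.log_div hvpos.ne' hzpos.ne', abs_le]
      constructor
      · rw [← Real.log_inv]
        apply Real.log_le_log (by positivity)
        rw [le_div_iff₀ hzpos]; linarith
      · apply Real.log_le_log (by positivity)
        rw [div_le_iff₀ hzpos]; linarith
    rw [abs_le] at hlog2 ⊢
    constructor <;> linarith [hlog2.1, hlog2.2]
  have e : dataThree.Fbase ((s3 : ℂ) * v) + 2 * αThree * Real.log ‖(z : ℂ) - c₃'‖ =
      (dataThree.Fbase ((s3 : ℂ) * v) + 2 * αThree * Real.log (s3 * ‖v - c₃'‖)) -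
        2 * αThree * (Real.log (s3 * ‖v - c₃'‖) - Real.log ‖(z : ℂ) - c₃'‖) := by ring
  rw [e]
  have ha : 0 ≤ 2 * αThree := by linarith [αThree_pos]
  calc |dataThree.Fbase ((s3 : ℂ) * v) + 2 * αThree * Real.log (s3 * ‖v - c₃'‖) -
        2 * αThree * (Real.log (s3 * ‖v - c₃'‖) - Real.log ‖(z : ℂ) - c₃'‖)|
      ≤ |dataThree.Fbase ((s3 : ℂ) * v) + 2 * αThree * Real.log (s3 * ‖v - c₃'‖)| +
        |2 * αThree * (Real.log (s3 * ‖v - c₃'‖) - Real.log ‖(z : ℂ) - c₃'‖)| := abs_sub _ _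
    _ ≤ K + 2 * αThree * (2 * Real.log 2) := by
        rw [abs_mul, abs_of_nonneg ha]
        gcongr

end NearCorner

/-! ## 9. Matching with `G₂^{Γ₀(3)}(·, c₃)` and the value at `i/√3` -/

section Matching

/-- The normalisation constant `C₃ := −#Stab(c₃)/α₃ = −24π²`. [folklore] -/
def CThree : ℝ := -(6 : ℝ) / αThree

/-- `C₃ = −24π²`. [folklore] -/
theorem CThree_eq : CThree = -(24 : ℝ) * π ^ 2 := by
  rw [CThree, αThree]
  have : (π : ℝ) ≠ 0 := Real.pi_ne_zero
  field_simp; norm_num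

variable (hreal : (dataThree.M₁ Complex.I).im = 0)
include hreal

/-- **`G₂^{Γ₀(3)}(z, c₃) = C₃ · FThree(z)` off the orbit of `c₃`** (uniqueness of the resolvent Green
function). [cite: GrossZagier1986, §II.2] -/
theorem higherGreen_eq_CThree_mul_FThree (z : ℍ) (hz : z ∉ MulAction.orbit (Gamma0 3) cmLevelThree) :
    higherGreen 3 2 1 z cmLevelThree = CThree * FThree z := by
  have h := higherGreen_eq_neg_card_div_mul three_pos (isResolventGreenLike_FThree hreal) αThree_pos.ne'
    (by
      obtain ⟨C, ε, hε, hC⟩ := FThree_log_bound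
      exact ⟨C, ε, hε, fun w hw hd => hC w hw hd⟩) z hz
  rw [h, card_stabilizer_cmLevelThree, CThree]
  norm_num

omit hreal in
/-- Coordinates of `cmLevelThree' = i/√3`. [folklore] -/
theorem coe_cmLevelThree' : ((cmLevelThree' : ℍ) : ℂ) = ⟨0, 1 / s3⟩ := rfl

omit hreal in
/-- `√3 · (i/√3) = i`. [folklore] -/
theorem sc_cmLevelThree' : sc cmLevelThree' = Complex.I := by
  rw [sc, coe_cmLevelThree']
  have hs : s3 ≠ 0 := s3_pos.ne'
  apply Complex.ext
  · simp
  · simp [Complex.mul_im]; field_simp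

omit hreal in
/-- `i/√3 ∈ 𝒟₃` (on the arc) and off the corner orbit. [folklore] -/
theorem cmLevelThree'_mem_fdThree : cmLevelThree' ∈ fdThree ∧ cmLevelThree' ∉ cornerOrb := by
  have hs : s3 ≠ 0 := s3_pos.ne'
  have him : cmLevelThree'.im = 1 / s3 := by rw [← UpperHalfPlane.coe_im, coe_cmLevelThree']
  have h13 : 1 / s3 = s3 / 3 := by field_simp; linarith [s3_mul_s3]
  refine ⟨⟨?_, ?_⟩, fun h => ?_⟩
  · rw [← UpperHalfPlane.coe_re, coe_cmLevelThree']; simp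
  · rw [coe_cmLevelThree', Complex.normSq_mk]
    have : (1 / s3) * (1 / s3) = 1 / 3 := by field_simp; linarith [s3_sq]
    nlinarith
  · have := im_le_of_mem_cornerOrb h
    rw [him, h13, show Real.sqrt 3 = s3 from rfl] at this
    linarith [s3_pos]

/-- `FThree(i/√3) = Fbase(i)`. [folklore] -/
theorem FThree_cmLevelThree' : FThree cmLevelThree' = dataThree.Fbase Complex.I := by
  obtain ⟨hfd, hno⟩ := cmLevelThree'_mem_fdThree
  rw [FThree_eq_of_rep hreal hno (mem_orbThree_self _) hfd, sc_cmLevelThree']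

/-- At `z = i/√3`: `G₂^{Γ₀(3)}(i/√3, c₃) = C₃ · Fbase(i)`. [cite: Zhou2015, Remark 9] -/
theorem higherGreen_cmLevelThree'_cmLevelThree :
    higherGreen 3 2 1 cmLevelThree' cmLevelThree = CThree * dataThree.Fbase Complex.I := by
  have hno : cmLevelThree' ∉ MulAction.orbit (Gamma0 3) cmLevelThree := fun h =>
    cmLevelThree'_mem_fdThree.2 ((mem_orbit_iff_mem_cornerOrb _).mp h)
  rw [higherGreen_eq_CThree_mul_FThree hreal _ hno, FThree_cmLevelThree' hreal]

end Matching

/-! ## 10. Assembly of Remark 9 (iv)a given the two real-axis inputs -/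

section Final

/-- `g₃(it) = f₃(i t/√3)`. [folklore] -/
theorem gThree_axisPt {t : ℝ} (ht : 0 < t) : gThree (EllipticCurves.ModularForms.axisPt t) = fThree (EllipticCurves.ModularForms.axisPt (t / s3)) := by
  rw [gThree]; congr 1
  apply UpperHalfPlane.ext
  rw [coe_scaleDown, EllipticCurves.ModularForms.coe_axisPt ht, EllipticCurves.ModularForms.coe_axisPt (div_pos ht s3_pos)]
  push_cast; ring

variable {r : ℝ → ℝ} (hr : ∀ t : ℝ, 0 < t → fThree (EllipticCurves.ModularForms.axisPt t) = (r t : ℂ))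
include hr

/-- `Im M₁(i) = 0` for the level-three datum when `f₃` is real on the imaginary axis. [folklore] -/
theorem M₁_I_im_eq_zero_three : (dataThree.M₁ Complex.I).im = 0 :=
  dataThree.M₁_I_im_eq_zero (r := fun t => r (t / s3)) fun t ht => by
    rw [dataThree_g, gThree_axisPt ht, hr _ (div_pos ht s3_pos)]

variable {L : ℝ} (hL : ∫ u in Ioi (1 / Real.sqrt 3), fThree (EllipticCurves.ModularForms.axisPt u) = (((108 * π)⁻¹ * L : ℝ) : ℂ))
include hL

omit hr in
/-- `∫_{t>1} g₃(it) dt = √3 ∫_{u>1/√3} f₃(iu) du`. [folklore] -/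
theorem integral_gThree_axis :
    ∫ t in Ioi (1 : ℝ), gThree (EllipticCurves.ModularForms.axisPt t) = (s3 : ℂ) * (((108 * π)⁻¹ * L : ℝ) : ℂ) := by
  have h1 : ∫ t in Ioi (1 : ℝ), gThree (EllipticCurves.ModularForms.axisPt t) = ∫ t in Ioi (1 : ℝ), (fun u => fThree (EllipticCurves.ModularForms.axisPt u)) (s3⁻¹ * t) := by
    refine setIntegral_congr_fun measurableSet_Ioi fun t ht => ?_
    rw [gThree_axisPt (zero_lt_one.trans ht)]
    simp [div_eq_inv_mul]
  rw [h1, integral_comp_mul_left_Ioi (fun u => fThree (EllipticCurves.ModularForms.axisPt u)) 1 (inv_pos.mpr s3_pos), inv_inv, mul_one,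
    show s3⁻¹ = 1 / Real.sqrt 3 by rw [one_div]; rfl, hL, Complex.real_smul]

/-- **Remark 9 (iv)a from the two axis inputs**:
`G₂^{Γ₀(3)}(c₃, i/√3) = −(4π/(3√3))·L` where `L = 108π ∫_{u>1/√3} f₃(iu) du`. [cite: Zhou2015, Remark 9] -/
theorem higherGreen_cmLevelThree_of_axis :
    higherGreen 3 2 1 cmLevelThree cmLevelThree' = -(4 * π / (3 * Real.sqrt 3)) * L := by
  rw [higherGreen_symm one_pos, higherGreen_cmLevelThree'_cmLevelThree (M₁_I_im_eq_zero_three hr), dataThree.Fbase_I,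
    dataThree.M₀_I, dataThree_g, integral_gThree_axis hL, CThree_eq]
  simp only [Complex.mul_im, Complex.I_re, Complex.I_im, Complex.ofReal_re, Complex.ofReal_im,
    Complex.mul_re, zero_mul, one_mul, zero_add, mul_zero, sub_zero, add_zero]
  have hπ : (π : ℝ) ≠ 0 := Real.pi_ne_zero
  have hs : Real.sqrt 3 ≠ 0 := s3_pos.ne'
  have h2 : s3 = Real.sqrt 3 := rfl
  rw [h2]
  field_simp
  have := s3_mul_s3
  rw [h2] at this
  linear_combination (-(144 : ℝ) * L) * this

end Final

end Literature.NumberTheory.Automorphic.GreenThree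

end
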